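import Mathlib
import Literature.NumberTheory.GaloisRepresentations.Trianguline
import HarnessLib

/-!
# `(φ, Γ)`-modules over the Robba ring: structures, Herr cohomology, graded classes, and the enriched datum

Requested notion `PhiGammaModuleRobba` (item `defn-PhiGammaModuleRobba`; route
`Langlands/WeightVelocityMonodromy`, cruxes `NonSplitGradedPiece`, `StrictTriangulationAtX`, support
`CGSArcOrthogonality`; also routes `NewtonPatching`, `CMFern`).  The request: `(φ, Γ_F)`-modules over
the Robba ring `𝓡_E(π_F)` of a `p`-adic field `F` with coefficients `E`, rank-one objects `𝓡_E(δ)`,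
the cohomology `H^i_{φ,γ}` with Liu's finiteness / Euler characteristic, `H¹_{φ,γ}(𝓡_E) ≅ Hom(Fˣ, E)`,
the `D_rig` correspondence with étale objects, and triangulations (ordered parameters, strictness,
graded pieces `gr_i` and their classes `c_i ∈ H¹(𝓡_E(δ_iδ_{i+1}⁻¹))`).

This file BUILDS ON `Literature.NumberTheory.GaloisRepresentations.Trianguline` (item
`defn-TriangulineAt`), which fixes: the bundled `(φ, Γ)`-ring `PhiGammaRing Γ E`
[cite: KedlayaPottharstXiao2014, Def. 2.2.2], framed (= free with a basis, given by matrices)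
`(φ, Γ)`-modules `FramedPhiGammaModule 𝓡 n` with `conj`/`IsIso`, upper-triangularity
`IsTriangularWith`/`IsTriangulableWith`, and the datum `PhiGammaModuleData p F E` (ring `𝓡_E(π_F)`
acted on by `Γ_F^abs = Gal(F̄/F)` through `Γ_F`, framed `Drig`, framed `charMod δ = 𝓡_E(π_F)(δ)`, with
its functoriality / full-faithfulness / rank-one axioms) and `IsTriangulineWith`, `TriangulineAt`.
Nothing of that is redefined here.  What the matrix picture cannot express — sub- and quotient
objects, invariants, twists, the Herr complex and its classes — is developed below as STRUCTURES on
modules over a `PhiGammaRing`, with the dictionary back to the framed picture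
(`FramedPhiGammaModule.toPhiGammaModule`, `toRankOneDatum`, `Triangulation.ofTriangular`), and the
datum is ENRICHED by extension (`PhiGammaModuleRobba extends PhiGammaModuleData`), as that file
prescribes ("facts needing more structure are to be stated for structures extending this one").

## Part 1 — rank-one data, `(φ, Γ)`-module structures, twists

* `PhiGammaRing.RankOneDatum 𝓡`: the structure constants `(α ∈ Rˣ, c : Γ → Rˣ)` of a free
  rank-one `(φ, Γ)`-module in a chosen basis (`φ e = α e`, `γ e = c_γ e`, crossed-homomorphism
  and commutation relations); for `F = ℚ_p`, `𝓡_A(δ)` is `α = δ(p)`, `c_γ = δ(γ)`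
  [cite: BellaicheChenevier2009, §2.3.1 (arXiv:math/0602340 numbering)],
  [cite: KedlayaPottharstXiao2014, Notation 6.2.2]; for general `F` a datum is `𝓡_A(π_F)(δ)`
  [cite: KedlayaPottharstXiao2014, Construction 6.2.4] in a chosen basis (= a `FramedPhiGammaModule 𝓡 1`,
  `FramedPhiGammaModule.toRankOneDatum`).  Data form a `CommGroup` (tensor product / dual —
  the structure `Trianguline.lean` defers); `IsEquiv` = isomorphic rank-one modules
  (`equivOfUnit`), `map` = transport along an equivariant change of rings.
* Base change to an `E`-algebra `A` (relative rings `𝓡_A = A ⊗_E 𝓡_E`, exact for `A/E` finite;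
  coefficients of a `PhiGammaRing` may be any commutative ring): `PhiGammaRing.baseChange`,
  `baseChangeMap σ = σ ⊗ 1` (specialisation, e.g. `E[ε]/ε² → E`), `toBaseChange = 1 ⊗ -`,
  `RankOneDatum.baseChange` [cite: KedlayaPottharstXiao2014, Def. 2.2.2]; on the datum side
  `PhiGammaModuleRobba.RelativeCharData` (`ofCharOver A`, KPX Construction 6.2.4 over `A`) with its
  predicate `IsCompatible`.
* `PhiGammaModule 𝓡 D`: a `φ`-semilinear `φ_D` and a semilinear `Γ`-action commuting with it, on a
  given `R`-module `D` [cite: KedlayaPottharstXiao2014, Def. 2.2.6, Def. 2.2.12]; KPX's standing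
  conditions are the predicates `IsFiniteProjective`, `IsPhiModule` (`R·φ(D) = D`, as in
  [cite: BellaicheChenevier2009, Def. 2.2.1 (arXiv:math/0602340 numbering)]), `IsContinuous`;
  `IsStable`, `IsSaturated`, `Equiv`; `unit`, `twist M d = M(δ)`, `RankOneDatum.toModule d = 𝓡(δ)`.
  A framed module IS such a structure on `Rⁿ` (`FramedPhiGammaModule.toPhiGammaModule`, from the
  proved `gammaOp_mul`, `phiOp_gammaOp` of `Trianguline.lean`).

## Part 2 — the Herr complex

`Herr.d0/d1/H0/Z1/B1/H1/B2/H2` for two commuting `E`-linear endomorphisms `f = φ`, `g = γ_K` of an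
`E`-module [cite: KedlayaPottharstXiao2014, Def. 2.3.3]; for a `(φ, Γ)`-module and `γ₀ ∈ Γ` the
complex on `M` (`M.H0/H1/H2 γ₀`) and on the invariants `M^Δ` of a set `Δ ⊆ Γ` normalised by `γ₀`
(`M.HΔ0/HΔ1/HΔ2`; KPX: `Δ_K` = `p`-torsion of `Γ_K`), the comparison `HΔ1toH1`, and the cup
product `cup : H¹(M) × H¹(R) → H²(M)` from KPX's cochain formula
`(x₁,x₂) ∪ (y₁,y₂) = γ(y₁) x₂ - φ(y₂) x₁` [cite: KedlayaPottharstXiao2014, Def. 2.3.10] with its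
descent to classes PROVED (`cupBilin_mem_B2_of_mem_B1(_left)`), and `cupOrthogonal c = c^⊥`
(Ding's `𝓛(D) = [D]^⊥`, [cite: Ding2019SimpleL, §3.1]).

## Part 3 — triangulations and graded classes

`Triangulation M n`: an adapted `R`-basis with based parameters and upper-triangular `φ`, `γ`
(over the Robba ring of a field equivalent to KPX's filtrations with rank-one graded pieces
[cite: KedlayaPottharstXiao2014, Def. 6.3.1], [cite: BellaicheChenevier2009, Def. 2.3.2 (arXiv:math/0602340 numbering)];
`Triangulation.ofTriangular` builds it from `IsTriangularWith` of `Trianguline.lean`);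
`IsTriangulineWith`; stability and saturation of the flag (proved); the off-diagonal entries
`phiCoeff`, `actCoeff`, the commutation identity `coord_phi_act_eq` (proved), the graded cocycle
and **its cocycle property `gradedCocycle_mem_Z1` (proved)**, the class
`gradedClass ∈ H¹(𝓡(δ_iδ_{i+1}⁻¹))`, `IsNonSplitAt` (Ding's "`D_i^{i+1}` non-split"), KPX's
strictness `IsStrictAt / IsStrict` (`dim H⁰((M/Fil_i)(δ⁻¹)) = 1`), and `MapsAlong` (transport of a
based triangulated module along a change of coefficients, e.g. reduction mod `ε`).

## Part 4 — the enriched datum `PhiGammaModuleRobba p F E extends PhiGammaModuleData p F E`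

New fields only: the topology of `𝓡_E(π_F)` and the continuity of `φ`, of each `σ`, of the orbit
maps [cite: KedlayaPottharstXiao2014, Def. 2.2.12]; `gen`, a lift of a topological generator `γ_F` of
`Γ_F/Δ_F`, with `dense_gen` [cite: KedlayaPottharstXiao2014, Notation 2.3.1] (`torsionKernel p F =
χ_cyc⁻¹(p-torsion) ⊇ H_F` cuts out `Δ_F`); `homToH1 : Hom(Fˣ,E) → H¹_{φ,γ_F}(𝓡_E)`
[cite: Ding2019SimpleL, §3.1]; `IsEtale`.  Derived: `𝓣.H0/H1/H2 M` (KPX's cohomology: Herr complex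
of `(φ, gen)` on `M^{torsionKernel}`), `H1toH1`, `IsCyclotomic` (`H_F` acts trivially),
`ofChar δ = (charMod δ).toRankOneDatum`, `IsStrictTriangulineRep` (+ `isTriangulineWith_iff`,
the dictionary with `Trianguline.lean`'s `IsTriangulineWith`).  Predicates (nothing asserted):
`HasLiuFiniteness d` [cite: KedlayaPottharstXiao2014, Thm. 2.3.11], `HasRankOneCohomology d`
[cite: KedlayaPottharstXiao2014, Prop. 6.2.8], `HasRankOneClassification`
[cite: KedlayaPottharstXiao2014, Thm. 6.2.14], `HasCFTIdentification` [cite: Ding2019SimpleL, §3.1],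
`HasDrigEtale` [cite: KedlayaPottharstXiao2014, Thm. 2.2.17], their conjunction `IsKPX d`.

## What is deliberately NOT here

* The Robba ring as a ring of Laurent series and its LF topology; `ψ`; induction `Ind_L^K`
  (all inside the intended instance; `PhiGammaModuleData.nonempty` of `Trianguline.lean` is the
  existence placeholder).
* Liu's Tate duality (needs duals `M^∨(1)`), Berger's `D_cris/D_st/D_dR` on `(φ, Γ)`-modules and
  the predicates crystalline / semistable / de Rham, `H¹_e, H¹_f, H¹_g` (the route's use —
  "`gr_i` crystalline iff `ord ∈ c_i^⊥`" [cite: Ding2019SimpleL, §3.1] — goes through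
  `cupOrthogonal` and `homToH1`); Kedlaya slopes / degrees as data (only the predicate `IsEtale`).
* `(φ, Γ)`-modules over non-finite affinoid `A` need completed tensor products; `baseChange` is the
  algebraic tensor product (correct for `A/E` finite, the case of first-order deformations).
* For `p = 2` with `Δ_F ≠ 1`, the graded classes and the cup product live on the full complex
  `C^•(M)`, of which KPX's `C^•(M^{Δ_F})` is a direct summand (`HΔ1toH1`, `H1toH1`); for `p ≠ 2`
  they coincide.

## Mathlib / Literature declarations used

From `Trianguline.lean`: `PhiGammaRing` (+ `gammaHom`, `phiGL`, `gammaGL`, `coe_phiGL`,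
`coe_gammaGL`), `FramedPhiGammaModule` (+ `phiOp`, `gammaOp`, `gammaOp_mul`, `phiOp_gammaOp`,
`matGamma_one`, `conj`, `IsIso`, `IsTriangularWith`, `phiScalar`, `gammaScalar`),
`PhiGammaModuleData` (+ `charPhi`, `charGamma`, `IsTriangulineWith`),
`FramedGaloisRep.IsTriangulineWith`; from `GaloisRep.lean`: `FramedGaloisRep`,
`GaloisRep.cyclotomicCharacter`.  Mathlib: `Module.Basis(.coord, .mem_span_image)`,
`Submodule.mkQ/liftQ/mapQ/linearMap_qext`, `LinearMap.mk₂/restrict`, `Matrix.mulVec`,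
`RingHom.map_det`, `CommGroup.primaryComponent`, `Subgroup.comap`, `ContinuousMonoidHom`.

## References

* K. S. Kedlaya, J. Pottharst, L. Xiao, *Cohomology of arithmetic families of `(φ, Γ)`-modules*,
  JAMS 27 (2014), arXiv:1203.5718 — §2.2 (Def. 2.2.2, 2.2.6, 2.2.12, Thm. 2.2.17), §2.3
  (Notation 2.3.1, Def. 2.3.3, Def. 2.3.10, Thm. 2.3.11), §6.2 (Notation 6.2.2, Constr. 6.2.4,
  Prop. 6.2.8, Thm. 6.2.14), §6.3 (Def. 6.3.1). [KedlayaPottharstXiao2014]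
* J. Bellaïche, G. Chenevier, *Families of Galois representations and Selmer groups*, Astérisque
  324 (2009), arXiv:math/0602340 — §2.2.2 Def. 2.2.1, §2.2.4–2.2.5 Prop. 2.2.6, §2.3.1
  Prop. 2.3.1, §2.3.2 Def. 2.3.2 (arXiv numbering). [BellaicheChenevier2009]
* Y. Ding, *Simple `𝓛`-invariants for `GL_n`*, Trans. AMS 372 (2019), arXiv:1807.10862 — §3.1,
  §3.3 Thm. 3.4. [Ding2019SimpleL]
* K. Nakamura, *Classification of two-dimensional split trianguline representations of `p`-adic
  fields*, Compositio 145 (2009), arXiv:0801.1230 — Thm. 1.1, Thm. 1.3. [Nakamura2009]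
* D. Hansen, *Universal eigenvarieties, trianguline Galois representations, and `p`-adic Langlands
  functoriality*, Crelle 730 (2017) — Def. 6.1.1 (the matrix/filtration dictionary).
  [HansenUniversalEigenvarieties2017]
* P. Colmez, *Représentations triangulines de dimension 2*, Astérisque 319 (2008) — origin of
  `𝓡(δ)` and of trianguline representations (`F = ℚ_p`), as attributed in KPX §6.3.
  [Colmez2008Trianguline]

## Design notes

* `PhiGammaModule` is a structure ON a given `R`-module (several structures on one carrier are
  needed: twists, all the `𝓡(δ)` on `R`), with `φ_D : D →+ D` plus a semilinearity field rather than
  `→ₛₗ[φ]` (composites along words in `φ, γ` would need a `RingHomCompTriple` per word).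
* A triangulation is recorded through an adapted basis (matrices upper triangular, as in
  `Trianguline.lean`): this makes the graded class an explicit cocycle
  `(x_i α_{i+1}⁻¹, y_i(γ₀) c_{i+1}(γ₀)⁻¹)` whose cocycle identity is a ring identity deduced from
  `φγ = γφ` (`coord_phi_act_eq`, `gradedCocycle_mem_Z1`).
* `Γ_F^abs` is not abelian, so invariants are taken under the NORMAL subgroup `torsionKernel`
  (normalised by `gen`), which is what `HΔ*` needs (`actₗ_mem_invariants`).
* Non-vacuity (scratch, not shipped): a unipotent rank-two structure over `ℚ` with its
  triangulation and `IsNonSplitAt` PROVED; a degenerate inhabitant of `PhiGammaModuleRobba 2 ℂ (ZMod 2)`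
  (`G_ℂ = 1`) showing the field axioms of the enriched datum are jointly satisfiable.
-/

noncomputable section

namespace Literature.NumberTheory.GaloisRepresentations

universe u v w x

/-! ## Part 1. Rank-one data, `(φ, Γ)`-module structures, twists, base change -/

/-! ### Helpers on a `(φ, Γ)`-ring (`PhiGammaRing Γ E` of `Trianguline.lean`) -/

namespace PhiGammaRing

variable {Γ : Type u} [Group Γ] {E : Type v} [CommRing E] (𝓡 : PhiGammaRing.{u, v, w} Γ E)

/-- `Γ` fixes the coefficients: `γ • (e · 1) = e · 1` (Mathlib `smul_algebraMap`). [folklore] -/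
lemma smul_algebraMap_eq (γ : Γ) (e : E) : γ • algebraMap E 𝓡.R e = algebraMap E 𝓡.R e :=
  smul_algebraMap γ e

/-- The action of `γ ∈ Γ` on the units `Rˣ` (a ring endomorphism maps units to units).
[folklore] -/
def smulUnits (γ : Γ) : 𝓡.Rˣ →* 𝓡.Rˣ :=
  Units.map (MulSemiringAction.toRingHom Γ 𝓡.R γ : 𝓡.R →* 𝓡.R)

/-- Unfolding lemma for `smulUnits` on values. [folklore] -/
@[simp] lemma val_smulUnits (γ : Γ) (u : 𝓡.Rˣ) : (𝓡.smulUnits γ u : 𝓡.R) = γ • (u : 𝓡.R) := rfl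

/-- `γ • u⁻¹ = (γ • u)⁻¹` for a unit `u`. [folklore] -/
lemma smul_units_inv (γ : Γ) (u : 𝓡.Rˣ) :
    γ • ((u⁻¹ : 𝓡.Rˣ) : 𝓡.R) = ((𝓡.smulUnits γ u)⁻¹ : 𝓡.Rˣ) := by
  rw [← map_inv, val_smulUnits]

/-- `φ` on the units `Rˣ`. [folklore] -/
def frobUnits : 𝓡.Rˣ →* 𝓡.Rˣ := Units.map (𝓡.frob : 𝓡.R →* 𝓡.R)

/-- Unfolding lemma for `frobUnits` on values. [folklore] -/
@[simp] lemma val_frobUnits (u : 𝓡.Rˣ) : (𝓡.frobUnits u : 𝓡.R) = 𝓡.frob (u : 𝓡.R) := rfl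

/-- `φ(u⁻¹) = φ(u)⁻¹` for a unit `u`. [folklore] -/
lemma frob_units_inv (u : 𝓡.Rˣ) :
    𝓡.frob ((u⁻¹ : 𝓡.Rˣ) : 𝓡.R) = ((𝓡.frobUnits u)⁻¹ : 𝓡.Rˣ) := by
  rw [← map_inv, val_frobUnits]

/-! ### Rank-one data -/

/-- A **rank-one datum** for the `(φ, Γ)`-ring `R`: the structure constants of a free rank-one
`(φ, Γ)`-module `R · e` in a chosen basis `e`, namely `φ(e) = α e` and `γ(e) = c_γ e` with
`α ∈ Rˣ` (the linearisation `φ^*(Re) → Re` is an isomorphism iff `α` is a unit), `c : Γ → Rˣ` a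
crossed homomorphism (`(γγ')(e) = γ(c_{γ'} e) = γ(c_{γ'}) c_γ e`), and the relation expressing
`φ γ = γ φ` on `e` (`γ(α) c_γ = φ(c_γ) α`).  For `K = ℚ_p` and a continuous character
`δ : ℚ_pˣ → Γ(X, 𝒪_X)ˣ`, `𝓡_X(δ)` is the datum `α = δ(p)`, `c_γ = δ(χ(γ))` (constants, so the two
relations hold trivially); for general `K` one obtains a datum from `𝓡_X(π_K)(δ)` by choosing a
basis. [cite: KedlayaPottharstXiao2014, Notation 6.2.2, Construction 6.2.4],
[cite: BellaicheChenevier2009, §2.3.1 (arXiv:math/0602340 numbering)] -/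
@[ext] structure RankOneDatum where
  /-- `φ(e) = α e`. -/
  α : 𝓡.Rˣ
  /-- `γ(e) = c γ • e`. -/
  c : Γ → 𝓡.Rˣ
  /-- Crossed-homomorphism relation `c_{γγ'} = c_γ · γ(c_{γ'})`. -/
  c_mul : ∀ γ γ' : Γ, (c (γ * γ') : 𝓡.R) = c γ * γ • (c γ' : 𝓡.R)
  /-- `φ` and `γ` commute on `e`: `γ(α) c_γ = φ(c_γ) α`. -/
  compat : ∀ γ : Γ, γ • (α : 𝓡.R) * c γ = 𝓡.frob (c γ) * α

namespace RankOneDatum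

variable {𝓡}

/-- `c_1 = 1` (from the crossed-homomorphism relation at `γ = γ' = 1`). [folklore] -/
@[simp] lemma c_one (d : 𝓡.RankOneDatum) : d.c 1 = 1 := by
  have h : (d.c 1 : 𝓡.R) = d.c 1 * d.c 1 := by simpa using d.c_mul 1 1
  have h2 : d.c 1 * d.c 1 = d.c 1 * 1 := Units.ext (by simpa using h.symm)
  exact mul_left_cancel h2

/-- The **trivial datum** (`α = 1`, `c = 1`): the unit object `R` with basis `1`. [folklore] -/
protected def one : 𝓡.RankOneDatum where
  α := 1
  c := fun _ => 1
  c_mul := fun γ γ' => by simp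
  compat := fun γ => by simp

/-- The **product** of rank-one data (`α α'`, `c c'`): the tensor product `R(δ) ⊗_R R(δ')` in the
basis `e ⊗ e'` (tensor-functoriality of `δ ↦ 𝓡(δ)`).
[cite: KedlayaPottharstXiao2014, Lemma 6.2.3, Construction 6.2.4] -/
protected def mul (d d' : 𝓡.RankOneDatum) : 𝓡.RankOneDatum where
  α := d.α * d'.α
  c := fun γ => d.c γ * d'.c γ
  c_mul := fun γ γ' => by
    simp only [Units.val_mul, d.c_mul, d'.c_mul, smul_mul']
    ring
  compat := fun γ => by
    simp only [Units.val_mul, smul_mul', map_mul]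
    calc γ • (d.α : 𝓡.R) * γ • (d'.α : 𝓡.R) * ((d.c γ : 𝓡.R) * (d'.c γ))
        = (γ • (d.α : 𝓡.R) * d.c γ) * (γ • (d'.α : 𝓡.R) * d'.c γ) := by ring
      _ = (𝓡.frob (d.c γ) * d.α) * (𝓡.frob (d'.c γ) * d'.α) := by rw [d.compat, d'.compat]
      _ = 𝓡.frob (d.c γ) * 𝓡.frob (d'.c γ) * ((d.α : 𝓡.R) * d'.α) := by ring

/-- The **inverse** datum (`α⁻¹`, `c⁻¹`): the dual `R(δ)^∨ = R(δ⁻¹)` in the dual basis.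
[cite: KedlayaPottharstXiao2014, Construction 6.2.4] -/
protected def inv (d : 𝓡.RankOneDatum) : 𝓡.RankOneDatum where
  α := d.α⁻¹
  c := fun γ => (d.c γ)⁻¹
  c_mul := fun γ γ' => by
    have hu : d.c (γ * γ') = d.c γ * 𝓡.smulUnits γ (d.c γ') := Units.ext (by simp [d.c_mul])
    rw [hu, mul_inv, Units.val_mul, 𝓡.smul_units_inv]
  compat := fun γ => by
    have hu : 𝓡.smulUnits γ d.α * d.c γ = 𝓡.frobUnits (d.c γ) * d.α :=
      Units.ext (by simpa using d.compat γ)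
    rw [𝓡.smul_units_inv, 𝓡.frob_units_inv, ← Units.val_mul, ← Units.val_mul, ← mul_inv,
      ← mul_inv, hu]

/-- Rank-one data form a **commutative group** under tensor product (so do isomorphism classes of
rank-one `(φ, Γ)`-modules; here already the based data do). [folklore] -/
instance instCommGroup : CommGroup 𝓡.RankOneDatum where
  mul := RankOneDatum.mul
  one := RankOneDatum.one
  inv := RankOneDatum.inv
  mul_assoc a b c := RankOneDatum.ext (mul_assoc _ _ _) (funext fun _ => mul_assoc _ _ _)
  one_mul a := RankOneDatum.ext (one_mul _) (funext fun _ => one_mul _)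
  mul_one a := RankOneDatum.ext (mul_one _) (funext fun _ => mul_one _)
  mul_comm a b := RankOneDatum.ext (mul_comm _ _) (funext fun _ => mul_comm _ _)
  inv_mul_cancel a := RankOneDatum.ext (inv_mul_cancel _) (funext fun _ => inv_mul_cancel _)

/-- The unit datum has `α = 1`. [folklore] -/
@[simp] lemma one_α : (1 : 𝓡.RankOneDatum).α = 1 := rfl
/-- The unit datum has `c = 1`. [folklore] -/
@[simp] lemma one_c (γ : Γ) : (1 : 𝓡.RankOneDatum).c γ = 1 := rfl
/-- `α` of a product is the product of the `α`'s. [folklore] -/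
@[simp] lemma mul_α (d d' : 𝓡.RankOneDatum) : (d * d').α = d.α * d'.α := rfl
/-- `c` of a product is the product of the `c`'s. [folklore] -/
@[simp] lemma mul_c (d d' : 𝓡.RankOneDatum) (γ : Γ) : (d * d').c γ = d.c γ * d'.c γ := rfl
/-- `α` of the inverse is the inverse of `α`. [folklore] -/
@[simp] lemma inv_α (d : 𝓡.RankOneDatum) : d⁻¹.α = d.α⁻¹ := rfl
/-- `c` of the inverse is the inverse of `c`. [folklore] -/
@[simp] lemma inv_c (d : 𝓡.RankOneDatum) (γ : Γ) : d⁻¹.c γ = (d.c γ)⁻¹ := rfl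

/-- **Isomorphism of rank-one data**: `d ≈ d'` iff the rank-one modules `R·e` (structure `d`) and
`R·e'` (structure `d'`) are isomorphic as `(φ, Γ)`-modules, i.e. iff `d'` is `d` rewritten in the
basis `u e` for a unit `u`: `α' u = α φ(u)`, `c'_γ u = c_γ γ(u)`. [folklore] -/
def IsEquiv (d d' : 𝓡.RankOneDatum) : Prop :=
  ∃ u : 𝓡.Rˣ, (d'.α : 𝓡.R) * u = d.α * 𝓡.frob u ∧
    ∀ γ : Γ, (d'.c γ : 𝓡.R) * u = d.c γ * γ • (u : 𝓡.R)

/-- Every datum is isomorphic to itself (`u = 1`). [folklore] -/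
lemma IsEquiv.refl (d : 𝓡.RankOneDatum) : IsEquiv d d :=
  ⟨1, by simp, fun γ => by simp⟩

/-- Isomorphism of rank-one data is symmetric (`u ↦ u⁻¹`). [folklore] -/
lemma IsEquiv.symm {d d' : 𝓡.RankOneDatum} (h : IsEquiv d d') : IsEquiv d' d := by
  obtain ⟨u, hα, hc⟩ := h
  refine ⟨u⁻¹, ?_, fun γ => ?_⟩
  · rw [𝓡.frob_units_inv]
    have hu : (u : 𝓡.R) * ↑u⁻¹ = 1 := Units.mul_inv u
    have hf : 𝓡.frob (u : 𝓡.R) * ↑(𝓡.frobUnits u)⁻¹ = 1 := Units.mul_inv (𝓡.frobUnits u)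
    linear_combination (-((((u⁻¹ : 𝓡.Rˣ) : 𝓡.R)) * ↑(𝓡.frobUnits u)⁻¹)) * hα +
      (-((d.α : 𝓡.R) * ↑u⁻¹)) * hf + ((d'.α : 𝓡.R) * ↑(𝓡.frobUnits u)⁻¹) * hu
  · rw [𝓡.smul_units_inv]
    have hu : (u : 𝓡.R) * ↑u⁻¹ = 1 := Units.mul_inv u
    have hs : γ • (u : 𝓡.R) * ↑(𝓡.smulUnits γ u)⁻¹ = 1 := Units.mul_inv (𝓡.smulUnits γ u)
    linear_combination (-((((u⁻¹ : 𝓡.Rˣ) : 𝓡.R)) * ↑(𝓡.smulUnits γ u)⁻¹)) * hc γ +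
      (-((d.c γ : 𝓡.R) * ↑u⁻¹)) * hs + ((d'.c γ : 𝓡.R) * ↑(𝓡.smulUnits γ u)⁻¹) * hu

/-- Isomorphism of rank-one data is transitive (`u, v ↦ v u`). [folklore] -/
lemma IsEquiv.trans {d d' d'' : 𝓡.RankOneDatum} (h : IsEquiv d d') (h' : IsEquiv d' d'') :
    IsEquiv d d'' := by
  obtain ⟨u, hα, hc⟩ := h
  obtain ⟨v, hα', hc'⟩ := h'
  refine ⟨v * u, ?_, fun γ => ?_⟩
  · rw [Units.val_mul, map_mul, ← mul_assoc, hα', mul_assoc, mul_comm (𝓡.frob v) (u : 𝓡.R),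
      ← mul_assoc, hα]
    ring
  · rw [Units.val_mul, smul_mul', ← mul_assoc, hc', mul_assoc, mul_comm (γ • (v : 𝓡.R)) (u : 𝓡.R),
      ← mul_assoc, hc]
    ring

/-- **Transport of a rank-one datum** along a ring map `f : R → R'` between `(φ, Γ)`-rings (over
possibly different coefficient rings) commuting with `φ` and with `Γ`: apply `f` to `α` and `c`
(`𝓡_A(δ) ⊗_{A,σ} B = 𝓡_B(σ ∘ δ)` for a map of coefficient rings). [cite: BellaicheChenevier2009, §2.3.1 (arXiv:math/0602340 numbering: before Prop. 2.3.1)] -/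
def map {E' : Type*} [CommRing E'] {𝓡' : PhiGammaRing Γ E'} (f : 𝓡.R →+* 𝓡'.R)
    (hφ : ∀ r, f (𝓡.frob r) = 𝓡'.frob (f r)) (hγ : ∀ (γ : Γ) r, f (γ • r) = γ • f r)
    (d : 𝓡.RankOneDatum) : 𝓡'.RankOneDatum where
  α := Units.map (f : 𝓡.R →* 𝓡'.R) d.α
  c γ := Units.map (f : 𝓡.R →* 𝓡'.R) (d.c γ)
  c_mul γ γ' := by simp only [Units.coe_map, MonoidHom.coe_coe, d.c_mul, map_mul, hγ]
  compat γ := by simp only [Units.coe_map, MonoidHom.coe_coe, ← hγ, ← hφ, ← map_mul, d.compat]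

/-- Unfolding lemma for the transported `α`. [folklore] -/
@[simp] lemma map_α {E' : Type*} [CommRing E'] {𝓡' : PhiGammaRing Γ E'} (f : 𝓡.R →+* 𝓡'.R)
    (hφ : ∀ r, f (𝓡.frob r) = 𝓡'.frob (f r)) (hγ : ∀ (γ : Γ) r, f (γ • r) = γ • f r)
    (d : 𝓡.RankOneDatum) : ((d.map f hφ hγ).α : 𝓡'.R) = f d.α := rfl

/-- Unfolding lemma for the transported `c`. [folklore] -/
@[simp] lemma map_c {E' : Type*} [CommRing E'] {𝓡' : PhiGammaRing Γ E'} (f : 𝓡.R →+* 𝓡'.R)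
    (hφ : ∀ r, f (𝓡.frob r) = 𝓡'.frob (f r)) (hγ : ∀ (γ : Γ) r, f (γ • r) = γ • f r)
    (d : 𝓡.RankOneDatum) (γ : Γ) : ((d.map f hφ hγ).c γ : 𝓡'.R) = f (d.c γ) := rfl

end RankOneDatum

end PhiGammaRing

/-! ### `(φ, Γ)`-modules -/

/-- A **`(φ, Γ)`-module structure** on an `R`-module `D` over the `(φ, Γ)`-ring `𝓡` (`R = 𝓡.R`):
an additive `φ`-semilinear endomorphism `phi = φ_D` (`φ_D(r x) = φ(r) φ_D(x)`) and a semilinear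
action `act` of `Γ` (`γ(r x) = γ(r) γ(x)`) commuting with `φ_D`.  KPX's `(φ, Γ_K)`-modules over
`𝓡_A(π_K)` are the structures with `D` finite projective, `φ^* D ≅ D` and continuous `Γ_K`-action
(`IsFiniteProjective`, `IsPhiModule`, `IsContinuous` below); the bare structure is KPX's "module
with commuting actions of `φ` and `Γ_K`" of Def. 2.3.3.
[cite: KedlayaPottharstXiao2014, Def. 2.2.6, Def. 2.2.12, Def. 2.3.3] -/
@[ext] structure PhiGammaModule {Γ : Type u} [Group Γ] {E : Type v} [CommRing E]
    (𝓡 : PhiGammaRing.{u, v, w} Γ E) (D : Type x) [AddCommGroup D] [Module 𝓡.R D] where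
  /-- The Frobenius `φ_D`. -/
  phi : D →+ D
  /-- `φ_D` is `φ`-semilinear. -/
  phi_smul : ∀ (r : 𝓡.R) (x : D), phi (r • x) = 𝓡.frob r • phi x
  /-- The action of `Γ` on `D` by additive maps. -/
  act : Γ → D →+ D
  /-- `1 ∈ Γ` acts as the identity. -/
  act_one : act 1 = AddMonoidHom.id D
  /-- `γ γ'` acts as `γ ∘ γ'`. -/
  act_mul : ∀ γ γ' : Γ, act (γ * γ') = (act γ).comp (act γ')
  /-- The action of `Γ` is semilinear. -/
  act_smul : ∀ (γ : Γ) (r : 𝓡.R) (x : D), act γ (r • x) = (γ • r) • act γ x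
  /-- `φ_D` commutes with `Γ`. -/
  phi_act : ∀ (γ : Γ) (x : D), phi (act γ x) = act γ (phi x)

namespace PhiGammaModule

variable {Γ : Type u} [Group Γ] {E : Type v} [CommRing E] {𝓡 : PhiGammaRing.{u, v, w} Γ E}
  {D : Type x} [AddCommGroup D] [Module 𝓡.R D]

/-- `γ = 1` acts as the identity. [folklore] -/
@[simp] lemma act_one_apply (M : PhiGammaModule 𝓡 D) (x : D) : M.act 1 x = x := by
  rw [M.act_one, AddMonoidHom.id_apply]

/-- `(γ γ')(x) = γ(γ'(x))`. [folklore] -/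
lemma act_mul_apply (M : PhiGammaModule 𝓡 D) (γ γ' : Γ) (x : D) :
    M.act (γ * γ') x = M.act γ (M.act γ' x) := by
  rw [M.act_mul, AddMonoidHom.comp_apply]

section Linear

variable [Module E D] [IsScalarTower E 𝓡.R D] (M : PhiGammaModule 𝓡 D)

/-- `φ_D` is `E`-linear (`φ` fixes `E`). [folklore] -/
lemma phi_smul_of_tower (e : E) (x : D) : M.phi (e • x) = e • M.phi x := by
  rw [← algebraMap_smul 𝓡.R e x, M.phi_smul, AlgHom.commutes, algebraMap_smul]

/-- `γ` acts `E`-linearly (`Γ` fixes `E`). [folklore] -/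
lemma act_smul_of_tower (γ : Γ) (e : E) (x : D) : M.act γ (e • x) = e • M.act γ x := by
  rw [← algebraMap_smul 𝓡.R e x, M.act_smul, 𝓡.smul_algebraMap_eq, algebraMap_smul]

/-- `φ_D` as an `E`-linear map. [folklore] -/
def phiₗ : D →ₗ[E] D where
  toFun := M.phi
  map_add' := map_add M.phi
  map_smul' := M.phi_smul_of_tower

/-- Unfolding lemma for `phiₗ`. [folklore] -/
@[simp] lemma phiₗ_apply (x : D) : M.phiₗ x = M.phi x := rfl

/-- The action of `γ` as an `E`-linear map. [folklore] -/
def actₗ (γ : Γ) : D →ₗ[E] D where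
  toFun := M.act γ
  map_add' := map_add (M.act γ)
  map_smul' := M.act_smul_of_tower γ

/-- Unfolding lemma for `actₗ`. [folklore] -/
@[simp] lemma actₗ_apply (γ : Γ) (x : D) : M.actₗ γ x = M.act γ x := rfl

/-- `φ_D` and `γ` commute as `E`-linear maps. [folklore] -/
lemma phiₗ_comp_actₗ (γ : Γ) : M.phiₗ ∘ₗ M.actₗ γ = M.actₗ γ ∘ₗ M.phiₗ :=
  LinearMap.ext fun x => M.phi_act γ x

/-- Commuting elements of `Γ` act by commuting `E`-linear maps. [folklore] -/
lemma actₗ_comm {γ γ' : Γ} (h : Commute γ γ') :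
    M.actₗ γ ∘ₗ M.actₗ γ' = M.actₗ γ' ∘ₗ M.actₗ γ :=
  LinearMap.ext fun x => by
    simp only [LinearMap.coe_comp, Function.comp_apply, actₗ_apply, ← act_mul_apply, h.eq]

end Linear

/-! ### The KPX conditions as predicates -/

/-- KPX's finiteness condition: `D` is a finite projective `R`-module.
[cite: KedlayaPottharstXiao2014, Def. 2.2.6] -/
def IsFiniteProjective (_M : PhiGammaModule 𝓡 D) : Prop :=
  Module.Finite 𝓡.R D ∧ Module.Projective 𝓡.R D

/-- KPX's **`φ`-module condition** "`φ^* D → D` is an isomorphism", rendered as: the `R`-span of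
`φ_D(D)` is `D` (surjectivity of the linearisation `R ⊗_{R,φ} D → D`, `r ⊗ x ↦ r φ_D(x)`).  For `D`
finite projective of constant rank, surjectivity of the linearisation is equivalent to
bijectivity (a surjection between finite projective modules of the same rank is an isomorphism),
so on such structures this is exactly KPX's condition. [cite: KedlayaPottharstXiao2014, Def. 2.2.6] -/
def IsPhiModule (M : PhiGammaModule 𝓡 D) : Prop :=
  Submodule.span 𝓡.R (Set.range M.phi) = ⊤

/-- KPX's **continuity condition**: every orbit map `γ ↦ γ(x)` is continuous (for the profinite
topology on `Γ_K` and the (LF/Banach) topology on `D`).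
[cite: KedlayaPottharstXiao2014, Def. 2.2.12, Remark 2.2.13] -/
def IsContinuous [TopologicalSpace Γ] [TopologicalSpace D] (M : PhiGammaModule 𝓡 D) : Prop :=
  ∀ x : D, Continuous fun γ : Γ => M.act γ x

/-- A submodule `N ⊆ D` is **stable** (is a `(φ, Γ)`-submodule) if `φ_D(N) ⊆ N` and `γ(N) ⊆ N`
for all `γ`. [cite: KedlayaPottharstXiao2014, Def. 6.3.1] -/
def IsStable (M : PhiGammaModule 𝓡 D) (N : Submodule 𝓡.R D) : Prop :=
  (∀ x ∈ N, M.phi x ∈ N) ∧ ∀ (γ : Γ), ∀ x ∈ N, M.act γ x ∈ N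

/-- A submodule is **saturated** if it is an `R`-direct summand (over the Robba ring of a field
— a finite product of Bézout domains — a submodule of a finite free module is saturated iff the
quotient is torsion-free iff it is a direct summand).
[cite: KedlayaPottharstXiao2014, Lemma 6.2.10, Def. 6.3.1] -/
def IsSaturated (_M : PhiGammaModule 𝓡 D) (N : Submodule 𝓡.R D) : Prop :=
  ∃ N' : Submodule 𝓡.R D, IsCompl N N'

/-- An **isomorphism of `(φ, Γ)`-modules**: an `R`-linear equivalence commuting with `φ` and with
the action of `Γ`. [cite: KedlayaPottharstXiao2014, Def. 2.2.12] -/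
structure Equiv {D' : Type*} [AddCommGroup D'] [Module 𝓡.R D'] (M : PhiGammaModule 𝓡 D)
    (M' : PhiGammaModule 𝓡 D') where
  /-- The underlying `R`-linear equivalence. -/
  toLinearEquiv : D ≃ₗ[𝓡.R] D'
  /-- Compatibility with `φ`. -/
  map_phi : ∀ x, toLinearEquiv (M.phi x) = M'.phi (toLinearEquiv x)
  /-- Compatibility with `Γ`. -/
  map_act : ∀ (γ : Γ) x, toLinearEquiv (M.act γ x) = M'.act γ (toLinearEquiv x)

/-- The identity isomorphism. [folklore] -/
def Equiv.refl (M : PhiGammaModule 𝓡 D) : M.Equiv M :=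
  ⟨LinearEquiv.refl _ _, fun _ => rfl, fun _ _ => rfl⟩

/-! ### The unit object, twists, rank-one objects -/

variable (𝓡) in
/-- The **unit object**: `R` itself with `φ` and the given action of `Γ`.
[cite: KedlayaPottharstXiao2014, Def. 2.2.12] -/
protected def unit : PhiGammaModule 𝓡 𝓡.R where
  phi := 𝓡.frob.toRingHom.toAddMonoidHom
  phi_smul r x := by simp [smul_eq_mul]
  act γ := DistribSMul.toAddMonoidHom 𝓡.R γ
  act_one := AddMonoidHom.ext fun x => one_smul Γ x
  act_mul γ γ' := AddMonoidHom.ext fun x => mul_smul γ γ' x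
  act_smul γ r x := smul_mul' γ r x
  phi_act γ x := 𝓡.frob_smul γ x

/-- Unfolding lemma: `φ` of the unit object is `𝓡.frob`. [folklore] -/
@[simp] lemma unit_phi_apply (x : 𝓡.R) : (PhiGammaModule.unit 𝓡).phi x = 𝓡.frob x := rfl

/-- Unfolding lemma: `Γ` acts on the unit object by the given action. [folklore] -/
@[simp] lemma unit_act_apply (γ : Γ) (x : 𝓡.R) : (PhiGammaModule.unit 𝓡).act γ x = γ • x := rfl

/-- The **twist** `M(δ) = M ⊗_R R(δ)` of a `(φ, Γ)`-module by a rank-one datum `d = (α, c)`, on the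
carrier of `M` (basis `x ↦ x ⊗ e`): `φ_{M(δ)}(x) = α φ_M(x)`, `γ_{M(δ)}(x) = c_γ γ_M(x)`.
[cite: KedlayaPottharstXiao2014, Construction 6.2.4] -/
def twist (M : PhiGammaModule 𝓡 D) (d : 𝓡.RankOneDatum) : PhiGammaModule 𝓡 D where
  phi := (DistribSMul.toAddMonoidHom D (d.α : 𝓡.R)).comp M.phi
  phi_smul r x := by
    simp only [AddMonoidHom.coe_comp, Function.comp_apply, DistribSMul.toAddMonoidHom_apply,
      M.phi_smul, smul_smul, mul_comm]
  act γ := (DistribSMul.toAddMonoidHom D (d.c γ : 𝓡.R)).comp (M.act γ)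
  act_one := AddMonoidHom.ext fun x => by simp
  act_mul γ γ' := AddMonoidHom.ext fun x => by
    simp only [AddMonoidHom.coe_comp, Function.comp_apply, DistribSMul.toAddMonoidHom_apply,
      d.c_mul, M.act_mul_apply, M.act_smul, smul_smul]
  act_smul γ r x := by
    simp only [AddMonoidHom.coe_comp, Function.comp_apply, DistribSMul.toAddMonoidHom_apply,
      M.act_smul, smul_smul, mul_comm]
  phi_act γ x := by
    simp only [AddMonoidHom.coe_comp, Function.comp_apply, DistribSMul.toAddMonoidHom_apply,
      M.phi_smul, M.act_smul, M.phi_act, smul_smul]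
    congr 1
    linear_combination -(d.compat γ)

/-- Unfolding lemma: `φ_{M(δ)}(x) = α • φ_M(x)`. [folklore] -/
@[simp] lemma twist_phi_apply (M : PhiGammaModule 𝓡 D) (d : 𝓡.RankOneDatum) (x : D) :
    (M.twist d).phi x = (d.α : 𝓡.R) • M.phi x := rfl

/-- Unfolding lemma: `γ_{M(δ)}(x) = c_γ • γ_M(x)`. [folklore] -/
@[simp] lemma twist_act_apply (M : PhiGammaModule 𝓡 D) (d : 𝓡.RankOneDatum) (γ : Γ) (x : D) :
    (M.twist d).act γ x = (d.c γ : 𝓡.R) • M.act γ x := rfl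

/-- Twisting preserves stability of a submodule. [folklore] -/
lemma IsStable.twist {M : PhiGammaModule 𝓡 D} {N : Submodule 𝓡.R D} (h : M.IsStable N)
    (d : 𝓡.RankOneDatum) : (M.twist d).IsStable N :=
  ⟨fun x hx => by simpa using N.smul_mem (d.α : 𝓡.R) (h.1 x hx),
    fun γ x hx => by simpa using N.smul_mem (d.c γ : 𝓡.R) (h.2 γ x hx)⟩

end PhiGammaModule

namespace PhiGammaRing.RankOneDatum

variable {Γ : Type u} [Group Γ] {E : Type v} [CommRing E] {𝓡 : PhiGammaRing.{u, v, w} Γ E}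

/-- The **rank-one `(φ, Γ)`-module `𝓡(δ) = R · e`** of a datum `d = (α, c)`, on the carrier `R`
(coordinate `r ↦ r e`): `φ(r e) = φ(r) α e`, `γ(r e) = γ(r) c_γ e`; it is the twist of the unit
object by `d`. [cite: KedlayaPottharstXiao2014, Notation 6.2.2, Construction 6.2.4],
[cite: BellaicheChenevier2009, §2.3.1 (arXiv:math/0602340 numbering)] -/
def toModule (d : 𝓡.RankOneDatum) : PhiGammaModule 𝓡 𝓡.R :=
  (PhiGammaModule.unit 𝓡).twist d

/-- Unfolding lemma: `φ_{𝓡(δ)}(r) = α φ(r)`. [folklore] -/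
@[simp] lemma toModule_phi_apply (d : 𝓡.RankOneDatum) (r : 𝓡.R) :
    d.toModule.phi r = d.α * 𝓡.frob r := rfl

/-- Unfolding lemma: `γ_{𝓡(δ)}(r) = c_γ γ(r)`. [folklore] -/
@[simp] lemma toModule_act_apply (d : 𝓡.RankOneDatum) (γ : Γ) (r : 𝓡.R) :
    d.toModule.act γ r = d.c γ * γ • r := rfl

/-- A unit `u` with `α' u = α φ(u)`, `c'_γ u = c_γ γ(u)` (a witness of `IsEquiv d d'`) gives the
isomorphism of `(φ, Γ)`-modules `𝓡(δ') ≅ 𝓡(δ)`, `r ↦ r u` (the change of basis `e' = u e`): so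
`IsEquiv` is exactly "isomorphic rank-one objects" for based data. [folklore] -/
def equivOfUnit {d d' : 𝓡.RankOneDatum} (u : 𝓡.Rˣ) (hα : (d'.α : 𝓡.R) * u = d.α * 𝓡.frob u)
    (hc : ∀ γ : Γ, (d'.c γ : 𝓡.R) * u = d.c γ * γ • (u : 𝓡.R)) :
    d'.toModule.Equiv d.toModule where
  toLinearEquiv :=
    { toFun := fun r => r * u
      map_add' := fun x y => add_mul x y _
      map_smul' := fun a x => mul_assoc a x _
      invFun := fun r => r * ↑u⁻¹
      left_inv := fun r => Units.mul_inv_cancel_right r u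
      right_inv := fun r => Units.inv_mul_cancel_right r u }
  map_phi r := by
    simp only [LinearEquiv.coe_mk, LinearMap.coe_mk, AddHom.coe_mk, toModule_phi_apply, map_mul]
    linear_combination (𝓡.frob r) * hα
  map_act γ r := by
    simp only [LinearEquiv.coe_mk, LinearMap.coe_mk, AddHom.coe_mk, toModule_act_apply, smul_mul']
    linear_combination (γ • r) * hc γ

/-- Isomorphic data have isomorphic rank-one modules. [folklore] -/
lemma IsEquiv.nonempty_equiv {d d' : 𝓡.RankOneDatum} (h : IsEquiv d d') :
    Nonempty (d'.toModule.Equiv d.toModule) := by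
  obtain ⟨u, hα, hc⟩ := h
  exact ⟨equivOfUnit u hα hc⟩

/-- The unit datum gives back the unit object. [folklore] -/
lemma toModule_one : (1 : 𝓡.RankOneDatum).toModule = PhiGammaModule.unit 𝓡 :=
  PhiGammaModule.ext (AddMonoidHom.ext fun x => by simp)
    (funext fun γ => AddMonoidHom.ext fun x => by simp)

end PhiGammaRing.RankOneDatum




/-! ### Base change of the coefficients (relative Robba rings `𝓡_A = A ⊗_E 𝓡_E`)

For an `E`-algebra `A`, `A ⊗_E R` with `φ_A = 1 ⊗ φ` and `γ_A = 1 ⊗ γ` is a `(φ, Γ)`-ring over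
`A`.  For `A` finite over `E` (e.g. Artinian local: `E[ε]/ε²`) and `R = 𝓡_E(π_K)` this is the
relative Robba ring `𝓡_A(π_K) = 𝓡(π_K) ⊗̂_{ℚ_p} A` of KPX (no completion is needed when `A` is a finite
free `E`-module), the coefficient ring of the first-order deformations in the
Colmez–Greenberg–Stevens formula [cite: KedlayaPottharstXiao2014, Def. 2.2.2],
[cite: Ding2019SimpleL, §3.3]. -/

namespace PhiGammaRing

open scoped TensorProduct

variable {Γ : Type u} [Group Γ] {E : Type v} [CommRing E] (𝓡 : PhiGammaRing.{u, v, w} Γ E)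
  (A : Type v) [CommRing A] [Algebra E A]

/-- The `A`-algebra endomorphism `1 ⊗ γ` of `A ⊗_E R`. [folklore] -/
def baseChangeActHom (γ : Γ) : A ⊗[E] 𝓡.R →ₐ[A] A ⊗[E] 𝓡.R :=
  Algebra.TensorProduct.map (AlgHom.id A A) (MulSemiringAction.toAlgHom E 𝓡.R γ)

/-- `1 ⊗ γ` on pure tensors. [folklore] -/
@[simp] lemma baseChangeActHom_tmul (γ : Γ) (a : A) (r : 𝓡.R) :
    𝓡.baseChangeActHom A γ (a ⊗ₜ r) = a ⊗ₜ (γ • r) := by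
  simp [baseChangeActHom]

/-- `1 ⊗ 1 = id`. [folklore] -/
lemma baseChangeActHom_one : 𝓡.baseChangeActHom A 1 = AlgHom.id A _ := by
  refine Algebra.TensorProduct.ext' fun a r => ?_
  simp

/-- `1 ⊗ (γγ') = (1 ⊗ γ) ∘ (1 ⊗ γ')`. [folklore] -/
lemma baseChangeActHom_mul (γ γ' : Γ) :
    𝓡.baseChangeActHom A (γ * γ') = (𝓡.baseChangeActHom A γ).comp (𝓡.baseChangeActHom A γ') := by
  refine Algebra.TensorProduct.ext' fun a r => ?_
  simp [mul_smul]

/-- The action `γ • (a ⊗ r) = a ⊗ γ(r)` of `Γ` on `A ⊗_E R` by `A`-algebra endomorphisms (a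
reducible definition, registered as an instance only through `PhiGammaRing.baseChange`).
[cite: KedlayaPottharstXiao2014, Def. 2.2.2] -/
@[reducible] def baseChangeAction : MulSemiringAction Γ (A ⊗[E] 𝓡.R) where
  smul γ x := 𝓡.baseChangeActHom A γ x
  one_smul x := by
    show 𝓡.baseChangeActHom A 1 x = x
    rw [baseChangeActHom_one]; rfl
  mul_smul γ γ' x := by
    show 𝓡.baseChangeActHom A (γ * γ') x = 𝓡.baseChangeActHom A γ (𝓡.baseChangeActHom A γ' x)
    rw [baseChangeActHom_mul]; rfl
  smul_zero γ := map_zero _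
  smul_add γ x y := map_add _ x y
  smul_one γ := map_one _
  smul_mul γ x y := map_mul _ x y

/-- **Base change of a `(φ, Γ)`-ring** to an `E`-algebra `A`: `A ⊗_E R` with `φ_A = 1 ⊗ φ`,
`γ_A = 1 ⊗ γ` (the relative Robba ring `𝓡_A(π_K)` when `R = 𝓡_E(π_K)` and `A/E` is finite).  The
nontriviality of `A ⊗_E R` required by `PhiGammaRing` is an instance argument; for `E` a field and
`A` nontrivial it is found automatically (Mathlib `Module.FaithfullyFlat.rTensor_nontrivial`, `R`
being free hence faithfully flat over `E`). [cite: KedlayaPottharstXiao2014, Def. 2.2.2] -/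
def baseChange [Nontrivial (A ⊗[E] 𝓡.R)] : PhiGammaRing.{u, v, max v w} Γ A where
  R := A ⊗[E] 𝓡.R
  action := 𝓡.baseChangeAction A
  smulComm :=
    letI := 𝓡.baseChangeAction A
    ⟨fun γ a x => map_smul (𝓡.baseChangeActHom A γ) a x⟩
  frob := Algebra.TensorProduct.map (AlgHom.id A A) 𝓡.frob
  frob_smul γ x := by
    show Algebra.TensorProduct.map (AlgHom.id A A) 𝓡.frob (𝓡.baseChangeActHom A γ x) =
      𝓡.baseChangeActHom A γ (Algebra.TensorProduct.map (AlgHom.id A A) 𝓡.frob x)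
    rw [← AlgHom.comp_apply, ← AlgHom.comp_apply]
    congr 1
    refine Algebra.TensorProduct.ext' fun a r => ?_
    simp [𝓡.frob_smul]

variable [Nontrivial (A ⊗[E] 𝓡.R)]

/-- The carrier of the base change is `A ⊗_E R` (definitionally). [folklore] -/
lemma baseChange_R : (𝓡.baseChange A).R = (A ⊗[E] 𝓡.R) := rfl

/-- `φ_A = 1 ⊗ φ` (definitionally). [folklore] -/
lemma baseChange_frob_def :
    ((𝓡.baseChange A).frob : (𝓡.baseChange A).R → (𝓡.baseChange A).R) =
      Algebra.TensorProduct.map (AlgHom.id A A) 𝓡.frob := rfl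

/-- `γ_A = 1 ⊗ γ` (definitionally). [folklore] -/
lemma baseChange_smul_def (γ : Γ) (x : (𝓡.baseChange A).R) :
    γ • x = 𝓡.baseChangeActHom A γ x := rfl

/-- `R → A ⊗_E R`, `r ↦ 1 ⊗ r` (Mathlib `includeRight`), as a ring map into the carrier of the base
change. [folklore] -/
def toBaseChange : 𝓡.R →+* (𝓡.baseChange A).R :=
  (Algebra.TensorProduct.includeRight : 𝓡.R →ₐ[E] A ⊗[E] 𝓡.R).toRingHom

/-- `r ↦ 1 ⊗ r` on elements. [folklore] -/
lemma toBaseChange_apply (r : 𝓡.R) : 𝓡.toBaseChange A r = ((1 : A) ⊗ₜ[E] r : A ⊗[E] 𝓡.R) := rfl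

/-- `1 ⊗ -` commutes with `φ`: `φ_A(1 ⊗ r) = 1 ⊗ φ(r)`. [folklore] -/
lemma baseChange_frob_toBaseChange (r : 𝓡.R) :
    (𝓡.baseChange A).frob (𝓡.toBaseChange A r) = 𝓡.toBaseChange A (𝓡.frob r) := by
  show Algebra.TensorProduct.map (AlgHom.id A A) 𝓡.frob ((1 : A) ⊗ₜ[E] r) = (1 : A) ⊗ₜ[E] 𝓡.frob r
  rw [Algebra.TensorProduct.map_tmul]
  rfl

/-- `1 ⊗ -` commutes with `Γ`: `γ • (1 ⊗ r) = 1 ⊗ γ(r)`. [folklore] -/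
lemma baseChange_smul_toBaseChange (γ : Γ) (r : 𝓡.R) :
    γ • 𝓡.toBaseChange A r = 𝓡.toBaseChange A (γ • r) :=
  𝓡.baseChangeActHom_tmul A γ 1 r

/-- **Specialisation of the coefficients**: an `E`-algebra map `σ : A → B` induces the
`(φ, Γ)`-equivariant ring map `σ ⊗ 1 : A ⊗_E R → B ⊗_E R` (e.g. reduction modulo `ε` along the
augmentation `E[ε]/ε² → E`). [cite: KedlayaPottharstXiao2014, Thm. 2.2.17] -/
def baseChangeMap {B : Type v} [CommRing B] [Algebra E B] [Nontrivial (B ⊗[E] 𝓡.R)] (σ : A →ₐ[E] B) :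
    (𝓡.baseChange A).R →+* (𝓡.baseChange B).R :=
  (Algebra.TensorProduct.map σ (AlgHom.id E 𝓡.R) : A ⊗[E] 𝓡.R →ₐ[E] B ⊗[E] 𝓡.R).toRingHom

/-- `σ ⊗ 1` on `1 ⊗ r`: `(σ ⊗ 1)(1 ⊗ r) = 1 ⊗ r`. [folklore] -/
@[simp] lemma baseChangeMap_toBaseChange {B : Type v} [CommRing B] [Algebra E B] [Nontrivial (B ⊗[E] 𝓡.R)]
    (σ : A →ₐ[E] B)
    (r : 𝓡.R) : 𝓡.baseChangeMap A σ (𝓡.toBaseChange A r) = 𝓡.toBaseChange B r := by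
  show Algebra.TensorProduct.map σ (AlgHom.id E 𝓡.R) ((1 : A) ⊗ₜ[E] r) = (1 : B) ⊗ₜ[E] r
  rw [Algebra.TensorProduct.map_tmul, map_one]
  rfl

/-- `σ ⊗ 1` on `a ⊗ 1`. [folklore] -/
lemma baseChangeMap_algebraMap {B : Type v} [CommRing B] [Algebra E B] [Nontrivial (B ⊗[E] 𝓡.R)]
    (σ : A →ₐ[E] B) (a : A) :
    𝓡.baseChangeMap A σ (algebraMap A (𝓡.baseChange A).R a) = algebraMap B (𝓡.baseChange B).R (σ a) := by
  show Algebra.TensorProduct.map σ (AlgHom.id E 𝓡.R) (a ⊗ₜ[E] (1 : 𝓡.R)) = σ a ⊗ₜ[E] (1 : 𝓡.R)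
  rw [Algebra.TensorProduct.map_tmul]
  rfl

/-- `σ ⊗ 1` commutes with `φ`. [folklore] -/
lemma baseChangeMap_frob {B : Type v} [CommRing B] [Algebra E B] [Nontrivial (B ⊗[E] 𝓡.R)]
    (σ : A →ₐ[E] B)
    (x : (𝓡.baseChange A).R) :
    𝓡.baseChangeMap A σ ((𝓡.baseChange A).frob x) =
      (𝓡.baseChange B).frob (𝓡.baseChangeMap A σ x) := by
  change Algebra.TensorProduct.map σ (AlgHom.id E 𝓡.R)
      (Algebra.TensorProduct.map (AlgHom.id A A) 𝓡.frob x) =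
    Algebra.TensorProduct.map (AlgHom.id B B) 𝓡.frob (Algebra.TensorProduct.map σ (AlgHom.id E 𝓡.R) x)
  induction x using TensorProduct.induction_on with
  | zero => simp only [map_zero]
  | tmul a r => simp only [Algebra.TensorProduct.map_tmul, AlgHom.id_apply]
  | add x y hx hy => simp only [map_add, hx, hy]

/-- `σ ⊗ 1` commutes with the action of `Γ`. [folklore] -/
lemma baseChangeMap_smul {B : Type v} [CommRing B] [Algebra E B] [Nontrivial (B ⊗[E] 𝓡.R)]
    (σ : A →ₐ[E] B) (γ : Γ)
    (x : (𝓡.baseChange A).R) :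
    𝓡.baseChangeMap A σ (γ • x) = γ • 𝓡.baseChangeMap A σ x := by
  change Algebra.TensorProduct.map σ (AlgHom.id E 𝓡.R) (𝓡.baseChangeActHom A γ x) =
    𝓡.baseChangeActHom B γ (Algebra.TensorProduct.map σ (AlgHom.id E 𝓡.R) x)
  induction x using TensorProduct.induction_on with
  | zero => simp only [map_zero]
  | tmul a r => simp only [Algebra.TensorProduct.map_tmul, AlgHom.id_apply, baseChangeActHom_tmul]
  | add x y hx hy => simp only [map_add, hx, hy]

namespace RankOneDatum

variable {𝓡}

/-- **Base change of a rank-one datum** along `R → A ⊗_E R` (`𝓡_E(δ) ↦ 𝓡_A(δ)` for an `E`-valued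
`δ` viewed as `A`-valued). [cite: KedlayaPottharstXiao2014, Construction 6.2.4] -/
def baseChange (d : 𝓡.RankOneDatum) : (𝓡.baseChange A).RankOneDatum where
  α := Units.map (𝓡.toBaseChange A : 𝓡.R →* (𝓡.baseChange A).R) d.α
  c γ := Units.map (𝓡.toBaseChange A : 𝓡.R →* (𝓡.baseChange A).R) (d.c γ)
  c_mul γ γ' := by
    simp only [Units.coe_map, MonoidHom.coe_coe, d.c_mul, map_mul, baseChange_smul_toBaseChange]
  compat γ := by
    simp only [Units.coe_map, MonoidHom.coe_coe, baseChange_smul_toBaseChange,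
      baseChange_frob_toBaseChange, ← map_mul, d.compat]

/-- Unfolding lemma for the base-changed `α`. [folklore] -/
@[simp] lemma baseChange_α (d : 𝓡.RankOneDatum) :
    ((d.baseChange A).α : (𝓡.baseChange A).R) = 𝓡.toBaseChange A d.α := rfl

/-- Unfolding lemma for the base-changed `c`. [folklore] -/
@[simp] lemma baseChange_c (d : 𝓡.RankOneDatum) (γ : Γ) :
    ((d.baseChange A).c γ : (𝓡.baseChange A).R) = 𝓡.toBaseChange A (d.c γ) := rfl

end RankOneDatum

end PhiGammaRing

/-! ## Part 2. The Herr complex and `(φ, Γ)`-cohomology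

For a module `V` with two commuting endomorphisms `f` (= `φ`) and `g` (= `γ_K`), KPX's **Herr
complex** is `C^• = [V --(f-1, g-1)--> V ⊕ V --((g-1) ⊕ (1-f))--> V]` in degrees `0, 1, 2`
[cite: KedlayaPottharstXiao2014, Def. 2.3.3]: `d⁰ x = ((f-1)x, (g-1)x)`,
`d¹(x, y) = (g-1)x - (f-1)y`.  We define `H⁰ = ker d⁰`, `Z¹ = ker d¹ ⊇ B¹ = im d⁰`, `H¹ = Z¹/B¹`,
`B² = im d¹`, `H² = V/B²` for `E`-linear `f, g` on an `E`-module `V`, then specialise to a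
`(φ, Γ)`-module `M` and `γ₀ ∈ Γ` with `V = D` (`M.H0 γ₀`, …) and with `V = D^Δ` the invariants of a
set `Δ ⊆ Γ` normalised by `γ₀` (`M.HΔ0 Δ γ₀`, …): KPX apply the complex to `M^{Δ_K}`, `Δ_K ⊆ Γ_K` the
`p`-torsion subgroup (trivial for `p ≠ 2`) and `γ_K` a topological generator of `Γ_K/Δ_K`
[cite: KedlayaPottharstXiao2014, Notation 2.3.1, Def. 2.3.3].  When `Δ = 1` the two versions are
the same complex; in general, as `2 ∈ E^×` for `ℚ_p ⊆ E`, `C^•(M) = C^•(M^{Δ}) ⊕ C^•(M^{Δ=-1})` and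
`H^i(M^Δ) ⊆ H^i(M)` is a direct summand. -/

namespace Herr

variable {E : Type u} [CommRing E] {V : Type x} [AddCommGroup V] [Module E V] (f g : V →ₗ[E] V)

/-- The differential `d⁰ : V → V ⊕ V`, `x ↦ ((f - 1) x, (g - 1) x)` of the Herr complex.
[cite: KedlayaPottharstXiao2014, Def. 2.3.3] -/
def d0 : V →ₗ[E] V × V := LinearMap.prod (f - 1) (g - 1)

/-- The differential `d¹ : V ⊕ V → V`, `(x, y) ↦ (g - 1) x + (1 - f) y` of the Herr complex.
[cite: KedlayaPottharstXiao2014, Def. 2.3.3] -/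
def d1 : V × V →ₗ[E] V := (g - 1) ∘ₗ LinearMap.fst E V V - (f - 1) ∘ₗ LinearMap.snd E V V

/-- Unfolding lemma for `d0`. [folklore] -/
@[simp] lemma d0_apply (x : V) : d0 f g x = (f x - x, g x - x) := rfl

/-- Unfolding lemma for `d1`. [folklore] -/
@[simp] lemma d1_apply (x : V × V) : d1 f g x = (g x.1 - x.1) - (f x.2 - x.2) := rfl

/-- `d¹ ∘ d⁰ = 0` when `f` and `g` commute. [cite: KedlayaPottharstXiao2014, Def. 2.3.3] -/
lemma d1_d0 (h : Commute f g) (x : V) : d1 f g (d0 f g x) = 0 := by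
  have hfg : f (g x) = g (f x) := LinearMap.congr_fun h.eq x
  simp only [d0_apply, d1_apply, map_sub, hfg]
  abel

/-- `H⁰ = ker d⁰ = {x : f x = x, g x = x}`. [cite: KedlayaPottharstXiao2014, Def. 2.3.3] -/
def H0 : Submodule E V := LinearMap.ker (d0 f g)

/-- Membership in `H⁰`: simultaneously fixed by `f` and `g`. [folklore] -/
lemma mem_H0_iff (x : V) : x ∈ H0 f g ↔ f x = x ∧ g x = x := by
  simp [H0, Prod.ext_iff, sub_eq_zero]

/-- The `1`-cocycles `Z¹ = ker d¹ = {(x, y) : (g - 1) x = (f - 1) y}`.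
[cite: KedlayaPottharstXiao2014, Def. 2.3.3] -/
def Z1 : Submodule E (V × V) := LinearMap.ker (d1 f g)

/-- Membership in `Z¹`: the cocycle condition `g x - x = f y - y`. [folklore] -/
lemma mem_Z1_iff (x : V × V) : x ∈ Z1 f g ↔ g x.1 - x.1 = f x.2 - x.2 := by
  simp [Z1, sub_eq_zero]

/-- The `1`-coboundaries `B¹ = im d⁰ = {((f - 1) z, (g - 1) z)}`.
[cite: KedlayaPottharstXiao2014, Def. 2.3.3] -/
def B1 : Submodule E (V × V) := LinearMap.range (d0 f g)

/-- Membership in `B¹`. [folklore] -/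
lemma mem_B1_iff (x : V × V) : x ∈ B1 f g ↔ ∃ z : V, (f z - z, g z - z) = x := by
  simp [B1]

/-- `B¹ ⊆ Z¹` when `f` and `g` commute. [folklore] -/
lemma B1_le_Z1 (h : Commute f g) : B1 f g ≤ Z1 f g := by
  rintro _ ⟨z, rfl⟩
  exact (LinearMap.mem_ker).2 (d1_d0 f g h z)

/-- `d⁰ z` is a cocycle when `f` and `g` commute. [folklore] -/
lemma d0_mem_Z1 (h : Commute f g) (z : V) : d0 f g z ∈ Z1 f g :=
  B1_le_Z1 f g h ⟨z, rfl⟩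

/-- **`H¹ = Z¹ / B¹`** of the Herr complex (as a quotient of the cocycles by the coboundaries lying
in them; no commutation hypothesis is needed to form it). [cite: KedlayaPottharstXiao2014, Def. 2.3.3] -/
abbrev H1 : Type x := ↥(Z1 f g) ⧸ (B1 f g).comap (Z1 f g).subtype

/-- The class of a cocycle in `H¹`. [folklore] -/
abbrev H1.mk : ↥(Z1 f g) →ₗ[E] H1 f g := Submodule.mkQ _

/-- Every class has a cocycle representative. [folklore] -/
lemma H1.mk_surjective : Function.Surjective (H1.mk f g) := Submodule.mkQ_surjective _

/-- A cocycle has zero class iff it is a coboundary. [folklore] -/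
lemma H1.mk_eq_zero_iff (x : Z1 f g) : H1.mk f g x = 0 ↔ (x : V × V) ∈ B1 f g := by
  simp [Submodule.mem_comap]

/-- The `2`-coboundaries `B² = im d¹ = (g - 1)V + (f - 1)V`. [cite: KedlayaPottharstXiao2014, Def. 2.3.3] -/
def B2 : Submodule E V := LinearMap.range (d1 f g)

/-- Membership in `B²`. [folklore] -/
lemma mem_B2_iff (x : V) : x ∈ B2 f g ↔ ∃ a b : V, (g a - a) - (f b - b) = x := by
  simp [B2, Prod.exists]

/-- **`H² = V / B²`** of the Herr complex (the complex stops in degree `2`).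
[cite: KedlayaPottharstXiao2014, Def. 2.3.3] -/
abbrev H2 : Type x := V ⧸ B2 f g

/-- The class of an element in `H²`. [folklore] -/
abbrev H2.mk : V →ₗ[E] H2 f g := Submodule.mkQ _

/-- An element has zero class in `H²` iff it is a `2`-coboundary. [folklore] -/
lemma H2.mk_eq_zero_iff (x : V) : H2.mk f g x = 0 ↔ x ∈ B2 f g := by
  simp

end Herr

namespace PhiGammaModule

variable {Γ : Type u} [Group Γ] {E : Type v} [CommRing E] {𝓡 : PhiGammaRing.{u, v, w} Γ E}
  {D : Type x} [AddCommGroup D] [Module 𝓡.R D] [Module E D] [IsScalarTower E 𝓡.R D]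
  (M : PhiGammaModule 𝓡 D) (γ₀ : Γ)

/-- `φ_D` and `γ₀` commute as `E`-linear endomorphisms. [folklore] -/
lemma commute_phiₗ_actₗ : Commute M.phiₗ (M.actₗ γ₀) := M.phiₗ_comp_actₗ γ₀

/-- `H⁰_{φ,γ₀}(M) = M^{φ = 1, γ₀ = 1}` (Herr complex of `M` itself, `Δ = 1`).
[cite: KedlayaPottharstXiao2014, Def. 2.3.3] -/
abbrev H0 : Submodule E D := Herr.H0 M.phiₗ (M.actₗ γ₀)

/-- `Z¹_{φ,γ₀}(M) ⊆ M ⊕ M`. [cite: KedlayaPottharstXiao2014, Def. 2.3.3] -/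
abbrev Z1 : Submodule E (D × D) := Herr.Z1 M.phiₗ (M.actₗ γ₀)

/-- `B¹_{φ,γ₀}(M) ⊆ M ⊕ M`. [cite: KedlayaPottharstXiao2014, Def. 2.3.3] -/
abbrev B1 : Submodule E (D × D) := Herr.B1 M.phiₗ (M.actₗ γ₀)

/-- `H¹_{φ,γ₀}(M)` (Herr complex of `M` itself, `Δ = 1`). [cite: KedlayaPottharstXiao2014, Def. 2.3.3] -/
abbrev H1 : Type x := Herr.H1 M.phiₗ (M.actₗ γ₀)

/-- `B²_{φ,γ₀}(M) ⊆ M`. [cite: KedlayaPottharstXiao2014, Def. 2.3.3] -/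
abbrev B2 : Submodule E D := Herr.B2 M.phiₗ (M.actₗ γ₀)

/-- `H²_{φ,γ₀}(M)` (Herr complex of `M` itself, `Δ = 1`). [cite: KedlayaPottharstXiao2014, Def. 2.3.3] -/
abbrev H2 : Type x := Herr.H2 M.phiₗ (M.actₗ γ₀)

/-! ### The complex on `Δ`-invariants -/

/-- The `E`-submodule `M^Δ` of elements fixed by every `δ ∈ Δ`. [cite: KedlayaPottharstXiao2014, Def. 2.3.3] -/
def invariants (Δ : Set Γ) : Submodule E D := ⨅ δ ∈ Δ, LinearMap.ker (M.actₗ δ - 1)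

/-- Membership in `M^Δ`. [folklore] -/
lemma mem_invariants_iff (Δ : Set Γ) (x : D) : x ∈ M.invariants Δ ↔ ∀ δ ∈ Δ, M.act δ x = x := by
  simp [invariants, Submodule.mem_iInf, sub_eq_zero]

/-- `φ_D` preserves `M^Δ`. [folklore] -/
lemma phiₗ_mem_invariants (Δ : Set Γ) {x : D} (hx : x ∈ M.invariants Δ) :
    M.phiₗ x ∈ M.invariants Δ := by
  rw [mem_invariants_iff] at hx ⊢
  intro δ hδ
  rw [phiₗ_apply, ← M.phi_act, hx δ hδ]

/-- `γ₀` preserves `M^Δ` when `Δ` is normalised by `γ₀` (`γ₀⁻¹ Δ γ₀ ⊆ Δ`; e.g. `Δ` a normal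
subgroup, or `Γ` abelian). [folklore] -/
lemma actₗ_mem_invariants (Δ : Set Γ) (hγ : ∀ δ ∈ Δ, γ₀⁻¹ * δ * γ₀ ∈ Δ) {x : D}
    (hx : x ∈ M.invariants Δ) : M.actₗ γ₀ x ∈ M.invariants Δ := by
  rw [mem_invariants_iff] at hx ⊢
  intro δ hδ
  have h : δ * γ₀ = γ₀ * (γ₀⁻¹ * δ * γ₀) := by group
  rw [actₗ_apply, ← act_mul_apply, h, act_mul_apply, hx _ (hγ δ hδ)]

/-- `φ` on `M^Δ`. [folklore] -/
def phiInv (Δ : Set Γ) : M.invariants Δ →ₗ[E] M.invariants Δ :=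
  M.phiₗ.restrict fun _ hx => M.phiₗ_mem_invariants Δ hx

/-- `γ₀` on `M^Δ` (for `Δ` normalised by `γ₀`). [folklore] -/
def actInv (Δ : Set Γ) (hγ : ∀ δ ∈ Δ, γ₀⁻¹ * δ * γ₀ ∈ Δ) : M.invariants Δ →ₗ[E] M.invariants Δ :=
  (M.actₗ γ₀).restrict fun _ hx => M.actₗ_mem_invariants γ₀ Δ hγ hx

/-- KPX's `H⁰_{φ,γ_K}(M)`: the Herr complex on `M^{Δ}`. [cite: KedlayaPottharstXiao2014, Def. 2.3.3] -/
abbrev HΔ0 (Δ : Set Γ) (hγ : ∀ δ ∈ Δ, γ₀⁻¹ * δ * γ₀ ∈ Δ) : Submodule E (M.invariants Δ) :=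
  Herr.H0 (M.phiInv Δ) (M.actInv γ₀ Δ hγ)

/-- KPX's `H¹_{φ,γ_K}(M)`: the Herr complex on `M^{Δ}`. [cite: KedlayaPottharstXiao2014, Def. 2.3.3] -/
abbrev HΔ1 (Δ : Set Γ) (hγ : ∀ δ ∈ Δ, γ₀⁻¹ * δ * γ₀ ∈ Δ) : Type x :=
  Herr.H1 (M.phiInv Δ) (M.actInv γ₀ Δ hγ)

/-- KPX's `H²_{φ,γ_K}(M)`: the Herr complex on `M^{Δ}`. [cite: KedlayaPottharstXiao2014, Def. 2.3.3] -/
abbrev HΔ2 (Δ : Set Γ) (hγ : ∀ δ ∈ Δ, γ₀⁻¹ * δ * γ₀ ∈ Δ) : Type x :=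
  Herr.H2 (M.phiInv Δ) (M.actInv γ₀ Δ hγ)

/-- Unfolding lemma for `phiInv` (on values). [folklore] -/
@[simp] lemma coe_phiInv_apply (Δ : Set Γ) (x : M.invariants Δ) :
    ((M.phiInv Δ x : M.invariants Δ) : D) = M.phi x := rfl

/-- Unfolding lemma for `actInv` (on values). [folklore] -/
@[simp] lemma coe_actInv_apply (Δ : Set Γ) (hγ : ∀ δ ∈ Δ, γ₀⁻¹ * δ * γ₀ ∈ Δ) (x : M.invariants Δ) :
    ((M.actInv γ₀ Δ hγ x : M.invariants Δ) : D) = M.act γ₀ x := rfl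

/-- The comparison map `H¹(C^•(M^Δ)) → H¹(C^•(M))` induced by the inclusion of complexes
`M^Δ ⊆ M` (an isomorphism when `Δ` acts trivially, e.g. `Δ_K = 1` for `p ≠ 2`; the inclusion of
a direct summand when `2 ∈ E^×`). [cite: KedlayaPottharstXiao2014, Def. 2.3.3] -/
def HΔ1toH1 (Δ : Set Γ) (hγ : ∀ δ ∈ Δ, γ₀⁻¹ * δ * γ₀ ∈ Δ) : M.HΔ1 γ₀ Δ hγ →ₗ[E] M.H1 γ₀ :=
  Submodule.mapQ _ _
    (((M.invariants Δ).subtype.prodMap (M.invariants Δ).subtype).restrict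
      (p := Herr.Z1 (M.phiInv Δ) (M.actInv γ₀ Δ hγ)) (q := M.Z1 γ₀) fun x hx => by
        rw [Herr.mem_Z1_iff] at hx ⊢
        have h := congrArg Subtype.val hx
        simpa using h)
    fun x hx => by
      obtain ⟨z, hz⟩ := (Herr.mem_B1_iff _ _ _).1 (Submodule.mem_comap.1 hx)
      refine Submodule.mem_comap.2 ((Herr.mem_B1_iff _ _ _).2 ⟨(z : D), ?_⟩)
      have h1 := congrArg (fun w : M.invariants Δ × M.invariants Δ => ((w.1 : D), (w.2 : D))) hz
      rw [Submodule.subtype_apply, LinearMap.coe_restrict_apply, LinearMap.prodMap_apply]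
      simpa using h1

/-! ### The cup product `H¹(M) × H¹(R) → H²(M)` -/

variable (𝓡 D) in
/-- The cup product on `1`-cochains, `C¹(M) × C¹(R) → C²(M ⊗_R R) = C²(M)`, as an `E`-bilinear
map: `(x₁, x₂) ∪ (y₁, y₂) = γ₀(y₁) x₂ - φ(y₂) x₁` (KPX's formula
`(x₁, x₂) ⊗ (y₁, y₂) ↦ x₂ ⊗ γ(y₁) - x₁ ⊗ φ(y₂)` for `M₁ = M`, `M₂ = R`; it only involves the
structure of `R` and the `R`-module `D`).
[cite: KedlayaPottharstXiao2014, Def. 2.3.10 and the display following it] -/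
def cupBilin : (D × D) →ₗ[E] (𝓡.R × 𝓡.R) →ₗ[E] D :=
  LinearMap.mk₂ E (fun x y => (γ₀ • y.1) • x.2 - (𝓡.frob y.2) • x.1)
    (fun x x' y => by simp only [Prod.fst_add, Prod.snd_add, smul_add]; abel)
    (fun e x y => by simp only [Prod.smul_fst, Prod.smul_snd, smul_comm _ e, smul_sub])
    (fun x y y' => by simp only [Prod.fst_add, Prod.snd_add, smul_add, map_add, add_smul]; abel)
    (fun e x y => by
      simp only [Prod.smul_fst, Prod.smul_snd, map_smul, smul_sub, smul_assoc, smul_comm γ₀ e])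

/-- Unfolding lemma for `cupBilin`. [folklore] -/
@[simp] lemma cupBilin_apply (x : D × D) (y : 𝓡.R × 𝓡.R) :
    cupBilin 𝓡 D γ₀ x y = (γ₀ • y.1) • x.2 - (𝓡.frob y.2) • x.1 := rfl

/-- Cocycle ∪ coboundary is a `2`-coboundary:
`x ∪ d⁰z = d¹(-(φ z) x₁, -(γ₀ z) x₂)` for `x ∈ Z¹(M)`. [folklore] -/
lemma cupBilin_mem_B2_of_mem_B1 {x : D × D} (hx : x ∈ M.Z1 γ₀) {y : 𝓡.R × 𝓡.R}
    (hy : y ∈ (PhiGammaModule.unit 𝓡).B1 γ₀) : cupBilin 𝓡 D γ₀ x y ∈ M.B2 γ₀ := by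
  rw [Herr.mem_Z1_iff] at hx
  obtain ⟨z, rfl⟩ := (Herr.mem_B1_iff _ _ _).1 hy
  rw [Herr.mem_B2_iff]
  refine ⟨-((𝓡.frob z) • x.1), -((γ₀ • z) • x.2), ?_⟩
  simp only [phiₗ_apply, actₗ_apply, unit_phi_apply, unit_act_apply, cupBilin_apply, map_neg,
    map_sub, smul_sub, M.act_smul, M.phi_smul, 𝓡.frob_smul] at hx ⊢
  generalize γ₀ • 𝓡.frob z = w at *
  generalize 𝓡.frob z = c at *
  generalize γ₀ • z = d at *
  linear_combination (norm := module) (-w) • hx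

/-- Coboundary ∪ cocycle is a `2`-coboundary: `d⁰m ∪ y = d¹(y₁ m, y₂ m)` for `y ∈ Z¹(R)`.
[folklore] -/
lemma cupBilin_mem_B2_of_mem_B1_left {x : D × D} (hx : x ∈ M.B1 γ₀) {y : 𝓡.R × 𝓡.R}
    (hy : y ∈ (PhiGammaModule.unit 𝓡).Z1 γ₀) : cupBilin 𝓡 D γ₀ x y ∈ M.B2 γ₀ := by
  rw [Herr.mem_Z1_iff] at hy
  obtain ⟨m, rfl⟩ := (Herr.mem_B1_iff _ _ _).1 hx
  rw [Herr.mem_B2_iff]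
  refine ⟨y.1 • m, y.2 • m, ?_⟩
  simp only [phiₗ_apply, actₗ_apply, unit_phi_apply, unit_act_apply, cupBilin_apply,
    M.act_smul, M.phi_smul] at hy ⊢
  generalize γ₀ • y.1 = a at *
  generalize 𝓡.frob y.2 = b at *
  have key : (a - y.1) • m = (b - y.2) • m := by rw [hy]
  linear_combination (norm := module) key

/-- The cup product with a fixed cocycle `x ∈ Z¹(M)`, as a map `H¹(R) → H²(M)`. [folklore] -/
def cupLeft (x : M.Z1 γ₀) : (PhiGammaModule.unit 𝓡).H1 γ₀ →ₗ[E] M.H2 γ₀ :=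
  Submodule.liftQ _ ((M.B2 γ₀).mkQ ∘ₗ (cupBilin 𝓡 D γ₀ x).comp (Submodule.subtype _))
    (fun y hy => by
      rw [LinearMap.mem_ker, LinearMap.comp_apply, LinearMap.comp_apply, Submodule.mkQ_apply,
        Submodule.Quotient.mk_eq_zero]
      exact M.cupBilin_mem_B2_of_mem_B1 γ₀ x.2 (Submodule.mem_comap.1 hy))

/-- Unfolding lemma for `cupLeft` on classes of cocycles. [folklore] -/
@[simp] lemma cupLeft_mk (x : M.Z1 γ₀) (y : (PhiGammaModule.unit 𝓡).Z1 γ₀) :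
    M.cupLeft γ₀ x (Submodule.Quotient.mk y) =
      Submodule.Quotient.mk (cupBilin 𝓡 D γ₀ x y) := rfl

/-- `x ↦ cupLeft x` is `E`-linear in the cocycle `x`. [folklore] -/
def cupLeftₗ : M.Z1 γ₀ →ₗ[E] (PhiGammaModule.unit 𝓡).H1 γ₀ →ₗ[E] M.H2 γ₀ where
  toFun := M.cupLeft γ₀
  map_add' x x' := Submodule.linearMap_qext _ (LinearMap.ext fun y => by
    simp [Submodule.Quotient.mk_add])
  map_smul' e x := Submodule.linearMap_qext _ (LinearMap.ext fun y => by
    simp [Submodule.Quotient.mk_smul])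

/-- Unfolding lemma for `cupLeftₗ`. [folklore] -/
@[simp] lemma cupLeftₗ_apply (x : M.Z1 γ₀) : M.cupLeftₗ γ₀ x = M.cupLeft γ₀ x := rfl

/-- The **cup product** `H¹_{φ,γ₀}(M) × H¹_{φ,γ₀}(R) → H²_{φ,γ₀}(M)` (as an `E`-bilinear map),
induced by `(x₁, x₂) ∪ (y₁, y₂) = γ₀(y₁) x₂ - φ(y₂) x₁`; it is well defined on classes by
`cupBilin_mem_B2_of_mem_B1` and `cupBilin_mem_B2_of_mem_B1_left`.  With `M = 𝓡_E(δ)` and the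
identifications `H¹(𝓡_E) ≅ Hom(Kˣ, E)`, `H²(𝓡_E(δ)) ≅ E` (for special `δ`) this is Ding's pairing
`⟨·,·⟩`. [cite: KedlayaPottharstXiao2014, Def. 2.3.10], [cite: Ding2019SimpleL, §3.1] -/
def cup : M.H1 γ₀ →ₗ[E] (PhiGammaModule.unit 𝓡).H1 γ₀ →ₗ[E] M.H2 γ₀ :=
  Submodule.liftQ _ (M.cupLeftₗ γ₀) (fun x hx => by
    rw [LinearMap.mem_ker]
    refine Submodule.linearMap_qext _ (LinearMap.ext fun y => ?_)
    rw [LinearMap.comp_apply, LinearMap.comp_apply, Submodule.mkQ_apply, cupLeftₗ_apply,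
      cupLeft_mk, LinearMap.zero_apply, Submodule.Quotient.mk_eq_zero]
    exact M.cupBilin_mem_B2_of_mem_B1_left γ₀ (Submodule.mem_comap.1 hx) y.2)

/-- Unfolding lemma for the cup product on classes of cocycles. [folklore] -/
@[simp] lemma cup_mk_mk (x : M.Z1 γ₀) (y : (PhiGammaModule.unit 𝓡).Z1 γ₀) :
    M.cup γ₀ (Submodule.Quotient.mk x) (Submodule.Quotient.mk y) =
      Submodule.Quotient.mk (cupBilin 𝓡 D γ₀ x y) := rfl

/-- The **orthogonal** `c^⊥ = {ψ ∈ H¹(R) : c ∪ ψ = 0}` of a class `c ∈ H¹(M)` (Ding's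
`𝓛(D) := [D]^⊥ ⊆ Hom(Lˣ, E) ≅ H¹(𝓡_E)`). [cite: Ding2019SimpleL, §3.1] -/
def cupOrthogonal (c : M.H1 γ₀) : Submodule E ((PhiGammaModule.unit 𝓡).H1 γ₀) :=
  LinearMap.ker (M.cup γ₀ c)

/-- Membership in `c^⊥`. [folklore] -/
lemma mem_cupOrthogonal_iff (c : M.H1 γ₀) (ψ : (PhiGammaModule.unit 𝓡).H1 γ₀) :
    ψ ∈ M.cupOrthogonal γ₀ c ↔ M.cup γ₀ c ψ = 0 := LinearMap.mem_ker

end PhiGammaModule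


/-! ## Part 3. Triangulations, graded pieces and their classes

A `(φ, Γ_K)`-module `M` of rank `d` over `𝓡_L(π_K)` is **trianguline with ordered parameters
`δ₁, …, δ_d`** if it has an increasing filtration `0 = Fil₀ ⊂ Fil₁ ⊂ ⋯ ⊂ Fil_d = M` by
`(φ, Γ_K)`-submodules with `gr_i ≅ 𝓡_L(π_K)(δ_i)` [cite: KedlayaPottharstXiao2014, Def. 6.3.1],
[cite: Colmez2008Trianguline, Introduction],
[cite: BellaicheChenevier2009, Def. 2.3.2 (arXiv:math/0602340 numbering)].  Since each `gr_i` is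
free of rank one, such a filtration admits an adapted basis `e₁, …, e_d` (`Fil_i = ⟨e₁, …, e_i⟩`),
and in an adapted basis the condition `gr_i ≅ 𝓡(δ_i)` with based datum `(α_i, c_i)` of `𝓡(δ_i)`
reads: `φ(e_i) ≡ α_i e_i`, `γ(e_i) ≡ c_i(γ) e_i (mod Fil_{i-1})` — the matrices of `φ` and of every
`γ` are upper triangular with the parameters on the diagonal ("trianguline").  `Triangulation M n`
records exactly this (0-indexed: `basis : Fin n → D`, `Fil k = ⟨e_0, …, e_{k-1}⟩ = fil basis k`).
For a consecutive pair `(i, i+1)` the rank-two graded piece `Fil_{i+2}/Fil_i` is an extension of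
`𝓡(δ_{i+1})` by `𝓡(δ_i)`; twisting by `δ_{i+1}⁻¹` and lifting the basis vector of the quotient
gives its class `c_i ∈ H¹_{φ,γ₀}(𝓡(δ_i δ_{i+1}⁻¹))` (`gradedClass`, with the cocycle identity
PROVED in `gradedCocycle_mem_Z1`), whose non-vanishing is "the graded piece is non-split"
(`IsNonSplitAt`) [cite: Ding2019SimpleL, §3.1].  Strictness of the triangulation at step `i`
is KPX's `dim_E H⁰((M/Fil_i)(δ_{i+1}⁻¹)) = 1` (`IsStrictAt`) [cite: KedlayaPottharstXiao2014, Def. 6.3.1]. -/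

namespace PhiGammaModule

variable {Γ : Type u} [Group Γ] {E : Type v} [CommRing E] {𝓡 : PhiGammaRing.{u, v, w} Γ E}
  {D : Type x} [AddCommGroup D] [Module 𝓡.R D]

/-- The flag of an ordered basis: `fil b k = ⟨b_j : j < k⟩` (so `fil b 0 = 0`, `fil b n = D`).
[cite: KedlayaPottharstXiao2014, Def. 6.3.1] -/
def fil {n : ℕ} (b : Module.Basis (Fin n) 𝓡.R D) (k : ℕ) : Submodule 𝓡.R D :=
  Submodule.span 𝓡.R (b '' {j : Fin n | (j : ℕ) < k})

section Fil

variable {n : ℕ} (b : Module.Basis (Fin n) 𝓡.R D)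

/-- Membership in `fil b k`: all coordinates of index `≥ k` vanish. [folklore] -/
lemma mem_fil_iff (k : ℕ) (v : D) : v ∈ fil b k ↔ ∀ j : Fin n, k ≤ (j : ℕ) → b.coord j v = 0 := by
  rw [fil, Module.Basis.mem_span_image]
  simp only [Set.subset_def, Finset.mem_coe, Finsupp.mem_support_iff, Set.mem_setOf_eq,
    Module.Basis.coord_apply]
  constructor
  · intro h j hj
    by_contra hne
    exact absurd (h j hne) (not_lt.2 hj)
  · intro h j hj
    by_contra hlt
    exact hj (h j (not_lt.1 hlt))

/-- Basis vectors of index `< k` lie in `fil b k`. [folklore] -/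
lemma basis_mem_fil {k : ℕ} {j : Fin n} (h : (j : ℕ) < k) : b j ∈ fil b k :=
  Submodule.subset_span ⟨j, h, rfl⟩

/-- The flag is increasing. [folklore] -/
lemma fil_mono : Monotone (fil b) := fun _ _ hkl =>
  Submodule.span_mono (Set.image_mono fun _ hj => lt_of_lt_of_le hj hkl)

/-- `fil b 0 = 0`. [folklore] -/
lemma fil_zero : fil b 0 = ⊥ := by
  simp [fil]

/-- `fil b k = D` for `k ≥ n`. [folklore] -/
lemma fil_eq_top {k : ℕ} (hk : n ≤ k) : fil b k = ⊤ := by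
  refine eq_top_iff.2 fun v _ => (mem_fil_iff b k v).2 fun j hj => ?_
  exact absurd (lt_of_lt_of_le j.2 (hk.trans hj)) (lt_irrefl _)

/-- Coordinates of index `≥ k` vanish on `fil b k`. [folklore] -/
lemma coord_eq_zero_of_mem_fil {k : ℕ} {v : D} (hv : v ∈ fil b k) {j : Fin n} (hj : k ≤ (j : ℕ)) :
    b.coord j v = 0 :=
  (mem_fil_iff b k v).1 hv j hj

/-- Peeling off the top coordinate: if `v ∈ fil b (i+1)` then `v - v_i e_i ∈ fil b i`. [folklore] -/
lemma sub_coord_smul_mem_fil {i : ℕ} (hi : i < n) {v : D} (hv : v ∈ fil b (i + 1)) :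
    v - b.coord ⟨i, hi⟩ v • b ⟨i, hi⟩ ∈ fil b i := by
  rw [mem_fil_iff] at hv ⊢
  intro j hj
  simp only [map_sub, map_smul, Module.Basis.coord_apply, Module.Basis.repr_self, smul_eq_mul,
    Finsupp.single_apply]
  by_cases hji : (⟨i, hi⟩ : Fin n) = j
  · subst hji
    simp
  · rw [if_neg hji, mul_zero, sub_zero]
    refine hv j (Nat.succ_le_of_lt (lt_of_le_of_ne hj fun h => hji (Fin.ext h)))

end Fil

/-- A **triangulation** of the `(φ, Γ)`-module `M` of rank `n`, with based parameters: an `R`-basis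
`e_0, …, e_{n-1}` of `D` adapted to a flag of `(φ, Γ)`-stable submodules `Fil_k = ⟨e_0, …, e_{k-1}⟩`
whose graded pieces are the rank-one objects of the data `param 0, …, param (n-1)`, i.e.
`φ(e_i) ≡ α_i e_i` and `γ(e_i) ≡ c_i(γ) e_i (mod Fil_i)`.  Over `𝓡_L(π_K)` (`L` a field) this is
KPX's triangulation with ordered parameters `δ₁, …, δ_n` after choosing bases of the `𝓡_L(π_K)(δ_i)`
and lifting them (every rank-one graded piece is free, so an adapted basis exists); the parameters
are recovered up to `RankOneDatum.IsEquiv`. [cite: KedlayaPottharstXiao2014, Def. 6.3.1],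
[cite: BellaicheChenevier2009, Def. 2.3.2 (arXiv:math/0602340 numbering)] -/
structure Triangulation (M : PhiGammaModule 𝓡 D) (n : ℕ) where
  /-- The adapted basis `e_0, …, e_{n-1}`. -/
  basis : Module.Basis (Fin n) 𝓡.R D
  /-- The based parameters `(α_i, c_i)` of the graded pieces. -/
  param : Fin n → 𝓡.RankOneDatum
  /-- `φ(e_i) ≡ α_i e_i (mod Fil_i)`. -/
  phi_basis : ∀ i : Fin n, M.phi (basis i) - ((param i).α : 𝓡.R) • basis i ∈ fil basis i
  /-- `γ(e_i) ≡ c_i(γ) e_i (mod Fil_i)`. -/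
  act_basis : ∀ (γ : Γ) (i : Fin n),
    M.act γ (basis i) - ((param i).c γ : 𝓡.R) • basis i ∈ fil basis i

/-- `M` is **trianguline with (based, ordered) parameters `δ`** if it admits a triangulation whose
parameters are isomorphic to `δ_0, …, δ_{n-1}` as rank-one objects.  (The triangulation is over
the given coefficients — Nakamura's *split* trianguline; KPX's Def. 6.3.1 allows enlarging the
coefficient field `L` first, which here means applying the predicate after `baseChange`.)
[cite: KedlayaPottharstXiao2014, Def. 6.3.1], [cite: Nakamura2009, §1 (Introduction: split trianguline)] -/
def IsTriangulineWith (M : PhiGammaModule 𝓡 D) {n : ℕ} (δ : Fin n → 𝓡.RankOneDatum) : Prop :=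
  ∃ T : M.Triangulation n, ∀ i, (T.param i).IsEquiv (δ i)

namespace Triangulation

variable {M : PhiGammaModule 𝓡 D} {n : ℕ} (T : M.Triangulation n)

/-- The flag `Fil_k` of a triangulation. [cite: KedlayaPottharstXiao2014, Def. 6.3.1] -/
abbrev Fil (k : ℕ) : Submodule 𝓡.R D := fil T.basis k

/-- `φ` preserves every `Fil_k`. [cite: KedlayaPottharstXiao2014, Def. 6.3.1] -/
lemma phi_mem_Fil (k : ℕ) {v : D} (hv : v ∈ T.Fil k) : M.phi v ∈ T.Fil k := by
  induction hv using Submodule.span_induction with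
  | mem v hv =>
    obtain ⟨j, hj, rfl⟩ := hv
    have h : M.phi (T.basis j) =
        (M.phi (T.basis j) - ((T.param j).α : 𝓡.R) • T.basis j) +
          ((T.param j).α : 𝓡.R) • T.basis j := by abel
    rw [h]
    exact add_mem (fil_mono T.basis (le_of_lt hj) (T.phi_basis j))
      (Submodule.smul_mem _ _ (basis_mem_fil T.basis hj))
  | zero => simp
  | add u v _ _ hu hv =>
    rw [map_add]
    exact add_mem hu hv
  | smul r v _ hv =>
    rw [M.phi_smul]
    exact Submodule.smul_mem _ _ hv

/-- Every `γ` preserves every `Fil_k`. [cite: KedlayaPottharstXiao2014, Def. 6.3.1] -/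
lemma act_mem_Fil (γ : Γ) (k : ℕ) {v : D} (hv : v ∈ T.Fil k) : M.act γ v ∈ T.Fil k := by
  induction hv using Submodule.span_induction with
  | mem v hv =>
    obtain ⟨j, hj, rfl⟩ := hv
    have h : M.act γ (T.basis j) =
        (M.act γ (T.basis j) - ((T.param j).c γ : 𝓡.R) • T.basis j) +
          ((T.param j).c γ : 𝓡.R) • T.basis j := by abel
    rw [h]
    exact add_mem (fil_mono T.basis (le_of_lt hj) (T.act_basis γ j))
      (Submodule.smul_mem _ _ (basis_mem_fil T.basis hj))
  | zero => simp
  | add u v _ _ hu hv =>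
    rw [map_add]
    exact add_mem hu hv
  | smul r v _ hv =>
    rw [M.act_smul]
    exact Submodule.smul_mem _ _ hv

/-- The `Fil_k` are `(φ, Γ)`-stable. [cite: KedlayaPottharstXiao2014, Def. 6.3.1] -/
lemma isStable_Fil (k : ℕ) : M.IsStable (T.Fil k) :=
  ⟨fun _ hv => T.phi_mem_Fil k hv, fun γ _ hv => T.act_mem_Fil γ k hv⟩

/-- The `Fil_k` are saturated (`⟨e_j : j ≥ k⟩` is a complement). [cite: KedlayaPottharstXiao2014, Def. 6.3.1] -/
lemma isSaturated_Fil (k : ℕ) : M.IsSaturated (T.Fil k) := by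
  refine ⟨Submodule.span 𝓡.R (T.basis '' {j : Fin n | ¬ (j : ℕ) < k}), ?_⟩
  have h := T.basis.linearIndependent
  have hd : Disjoint (fil T.basis k) (Submodule.span 𝓡.R (T.basis '' {j : Fin n | ¬ (j : ℕ) < k})) := by
    refine (h.disjoint_span_image ?_)
    exact Set.disjoint_left.2 fun j hj hj' => hj' hj
  refine ⟨hd, codisjoint_iff.2 ?_⟩
  have hu : {j : Fin n | (j : ℕ) < k} ∪ {j : Fin n | ¬ (j : ℕ) < k} = Set.univ :=
    Set.eq_univ_of_forall fun j => by
      simp only [Set.mem_union, Set.mem_setOf_eq]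
      exact em _
  change Submodule.span 𝓡.R _ ⊔ Submodule.span 𝓡.R _ = ⊤
  rw [← Submodule.span_union, ← Set.image_union, hu, Set.image_univ, T.basis.span_eq]

/-- The diagonal entry of `φ`: `e_i^*(φ e_i) = α_i`. [folklore] -/
lemma coord_phi_self (i : Fin n) : T.basis.coord i (M.phi (T.basis i)) = (T.param i).α := by
  have h := coord_eq_zero_of_mem_fil T.basis (T.phi_basis i) (le_refl (i : ℕ))
  simpa [sub_eq_zero, Module.Basis.repr_self] using h

/-- The diagonal entry of `γ`: `e_i^*(γ e_i) = c_i(γ)`. [folklore] -/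
lemma coord_act_self (γ : Γ) (i : Fin n) :
    T.basis.coord i (M.act γ (T.basis i)) = (T.param i).c γ := by
  have h := coord_eq_zero_of_mem_fil T.basis (T.act_basis γ i) (le_refl (i : ℕ))
  simpa [sub_eq_zero, Module.Basis.repr_self] using h

section Graded

variable (γ₀ : Γ) (i : ℕ) (hi : i + 1 < n)

/-- The off-diagonal entry `x_i = e_i^*(φ e_{i+1})` of `φ` on the graded piece `(i, i+1)`. [folklore] -/
def phiCoeff : 𝓡.R := T.basis.coord ⟨i, Nat.lt_of_succ_lt hi⟩ (M.phi (T.basis ⟨i + 1, hi⟩))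

/-- The off-diagonal entry `y_i(γ) = e_i^*(γ e_{i+1})` of `γ` on the graded piece `(i, i+1)`.
[folklore] -/
def actCoeff (γ : Γ) : 𝓡.R := T.basis.coord ⟨i, Nat.lt_of_succ_lt hi⟩ (M.act γ (T.basis ⟨i + 1, hi⟩))

/-- The parameter `δ_i δ_{i+1}⁻¹` of the twisted graded piece, as a based datum. [cite: Ding2019SimpleL, §3.1] -/
def ratioParam : 𝓡.RankOneDatum :=
  T.param ⟨i, Nat.lt_of_succ_lt hi⟩ * (T.param ⟨i + 1, hi⟩)⁻¹

/-- `φ e_{i+1} = α_{i+1} e_{i+1} + x_i e_i + (element of Fil_i)`. [folklore] -/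
lemma phi_basis_succ_decomp :
    M.phi (T.basis ⟨i + 1, hi⟩) - ((T.param ⟨i + 1, hi⟩).α : 𝓡.R) • T.basis ⟨i + 1, hi⟩ -
      T.phiCoeff i hi • T.basis ⟨i, Nat.lt_of_succ_lt hi⟩ ∈ T.Fil i := by
  have h1 := T.phi_basis ⟨i + 1, hi⟩
  have h2 := sub_coord_smul_mem_fil T.basis (Nat.lt_of_succ_lt hi) h1
  have hc : T.basis.coord ⟨i, Nat.lt_of_succ_lt hi⟩
      (M.phi (T.basis ⟨i + 1, hi⟩) - ((T.param ⟨i + 1, hi⟩).α : 𝓡.R) • T.basis ⟨i + 1, hi⟩) =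
      T.phiCoeff i hi := by
    simp [phiCoeff, Module.Basis.repr_self, Fin.ext_iff]
  rwa [hc] at h2

/-- `γ e_{i+1} = c_{i+1}(γ) e_{i+1} + y_i(γ) e_i + (element of Fil_i)`. [folklore] -/
lemma act_basis_succ_decomp (γ : Γ) :
    M.act γ (T.basis ⟨i + 1, hi⟩) - ((T.param ⟨i + 1, hi⟩).c γ : 𝓡.R) • T.basis ⟨i + 1, hi⟩ -
      T.actCoeff i hi γ • T.basis ⟨i, Nat.lt_of_succ_lt hi⟩ ∈ T.Fil i := by
  have h1 := T.act_basis γ ⟨i + 1, hi⟩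
  have h2 := sub_coord_smul_mem_fil T.basis (Nat.lt_of_succ_lt hi) h1
  have hc : T.basis.coord ⟨i, Nat.lt_of_succ_lt hi⟩
      (M.act γ (T.basis ⟨i + 1, hi⟩) - ((T.param ⟨i + 1, hi⟩).c γ : 𝓡.R) • T.basis ⟨i + 1, hi⟩) =
      T.actCoeff i hi γ := by
    simp [actCoeff, Module.Basis.repr_self, Fin.ext_iff]
  rwa [hc] at h2

/-- The **commutation identity on the graded piece**: comparing the `e_i`-coordinates of
`φ(γ e_{i+1}) = γ(φ e_{i+1})` gives `φ(c_{i+1}) x + φ(y) α_i = γ(α_{i+1}) y + γ(x) c_i`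
(`x = x_i`, `y = y_i(γ)`). [folklore] -/
theorem coord_phi_act_eq (γ : Γ) :
    𝓡.frob ((T.param ⟨i + 1, hi⟩).c γ : 𝓡.R) * T.phiCoeff i hi +
        𝓡.frob (T.actCoeff i hi γ) * ((T.param ⟨i, Nat.lt_of_succ_lt hi⟩).α : 𝓡.R) =
      γ • ((T.param ⟨i + 1, hi⟩).α : 𝓡.R) * T.actCoeff i hi γ +
        γ • T.phiCoeff i hi * ((T.param ⟨i, Nat.lt_of_succ_lt hi⟩).c γ : 𝓡.R) := by
  set lo : Fin n := ⟨i, Nat.lt_of_succ_lt hi⟩ with hlo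
  set hi' : Fin n := ⟨i + 1, hi⟩ with hhi
  -- the two decompositions `φ e_{i+1} = α e_{i+1} + x e_i + l₁`, `γ e_{i+1} = c e_{i+1} + y e_i + l₂`
  set l₁ := M.phi (T.basis hi') - ((T.param hi').α : 𝓡.R) • T.basis hi' -
    T.phiCoeff i hi • T.basis lo with hl₁
  set l₂ := M.act γ (T.basis hi') - ((T.param hi').c γ : 𝓡.R) • T.basis hi' -
    T.actCoeff i hi γ • T.basis lo with hl₂
  have hl₁F : l₁ ∈ T.Fil i := T.phi_basis_succ_decomp i hi
  have hl₂F : l₂ ∈ T.Fil i := T.act_basis_succ_decomp i hi γ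
  have e1 : M.phi (T.basis hi') =
      ((T.param hi').α : 𝓡.R) • T.basis hi' + T.phiCoeff i hi • T.basis lo + l₁ := by
    rw [hl₁]; abel
  have e2 : M.act γ (T.basis hi') =
      ((T.param hi').c γ : 𝓡.R) • T.basis hi' + T.actCoeff i hi γ • T.basis lo + l₂ := by
    rw [hl₂]; abel
  -- coordinates along `e_i`
  have c0 : ∀ v ∈ T.Fil i, T.basis.coord lo v = 0 := fun v hv =>
    coord_eq_zero_of_mem_fil T.basis hv (le_refl i)
  have hx : T.basis.coord lo (M.phi (T.basis hi')) = T.phiCoeff i hi := rfl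
  have hy : T.basis.coord lo (M.act γ (T.basis hi')) = T.actCoeff i hi γ := rfl
  have L : T.basis.coord lo (M.phi (M.act γ (T.basis hi'))) =
      𝓡.frob ((T.param hi').c γ : 𝓡.R) * T.phiCoeff i hi +
        𝓡.frob (T.actCoeff i hi γ) * ((T.param lo).α : 𝓡.R) := by
    rw [e2]
    simp only [map_add, M.phi_smul, map_smul, smul_eq_mul, hx, T.coord_phi_self,
      c0 _ (T.phi_mem_Fil i hl₂F), add_zero]
  have R : T.basis.coord lo (M.act γ (M.phi (T.basis hi'))) =
      γ • ((T.param hi').α : 𝓡.R) * T.actCoeff i hi γ +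
        γ • T.phiCoeff i hi * ((T.param lo).c γ : 𝓡.R) := by
    rw [e1]
    simp only [map_add, M.act_smul, map_smul, smul_eq_mul, hy, T.coord_act_self,
      c0 _ (T.act_mem_Fil γ i hl₁F), add_zero]
  rw [← L, ← R, M.phi_act]

/-- The representative cocycle of the graded piece `(i, i+1)` in the Herr complex of
`𝓡(δ_i δ_{i+1}⁻¹)`: `(x_i α_{i+1}⁻¹, y_i(γ₀) c_{i+1}(γ₀)⁻¹)` — the value of `(φ - 1, γ₀ - 1)` on
the lift `ē_{i+1} ⊗ e^∨_{i+1}` of the basis vector of the quotient `𝓡` in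
`0 → 𝓡(δ_iδ_{i+1}⁻¹) → gr(δ_{i+1}⁻¹) → 𝓡 → 0`. [cite: Ding2019SimpleL, §3.1] -/
def gradedCocycle : 𝓡.R × 𝓡.R :=
  (T.phiCoeff i hi * (((T.param ⟨i + 1, hi⟩).α⁻¹ : 𝓡.Rˣ) : 𝓡.R),
    T.actCoeff i hi γ₀ * ((((T.param ⟨i + 1, hi⟩).c γ₀)⁻¹ : 𝓡.Rˣ) : 𝓡.R))

/-- **The graded cocycle is a cocycle** of the Herr complex of `𝓡(δ_i δ_{i+1}⁻¹)` (this is the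
commutation identity `coord_phi_act_eq` divided by the unit `α_{i+1} φ(c_{i+1}(γ₀))`). [folklore] -/
theorem gradedCocycle_mem_Z1 :
    T.gradedCocycle γ₀ i hi ∈ (T.ratioParam i hi).toModule.Z1 γ₀ := by
  rw [Herr.mem_Z1_iff]
  have key := T.coord_phi_act_eq i hi γ₀
  have hcompat := (T.param ⟨i + 1, hi⟩).compat γ₀
  simp only [phiₗ_apply, actₗ_apply, PhiGammaRing.RankOneDatum.toModule_phi_apply,
    PhiGammaRing.RankOneDatum.toModule_act_apply, gradedCocycle, ratioParam,
    PhiGammaRing.RankOneDatum.mul_α, PhiGammaRing.RankOneDatum.inv_α,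
    PhiGammaRing.RankOneDatum.mul_c, PhiGammaRing.RankOneDatum.inv_c, Units.val_mul, smul_mul',
    map_mul, 𝓡.smul_units_inv, 𝓡.frob_units_inv]
  have ha : (((T.param ⟨i + 1, hi⟩).α⁻¹ : 𝓡.Rˣ) : 𝓡.R) * (T.param ⟨i + 1, hi⟩).α = 1 :=
    Units.inv_mul _
  have hc : ((((T.param ⟨i + 1, hi⟩).c γ₀)⁻¹ : 𝓡.Rˣ) : 𝓡.R) * (T.param ⟨i + 1, hi⟩).c γ₀ = 1 :=
    Units.inv_mul _
  have hs : (((𝓡.smulUnits γ₀ (T.param ⟨i + 1, hi⟩).α)⁻¹ : 𝓡.Rˣ) : 𝓡.R) *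
      γ₀ • ((T.param ⟨i + 1, hi⟩).α : 𝓡.R) = 1 := Units.inv_mul _
  have hf : (((𝓡.frobUnits ((T.param ⟨i + 1, hi⟩).c γ₀))⁻¹ : 𝓡.Rˣ) : 𝓡.R) *
      𝓡.frob ((T.param ⟨i + 1, hi⟩).c γ₀ : 𝓡.R) = 1 := Units.inv_mul _
  -- clear denominators: the goal is `key` multiplied by the unit `α_{i+1}⁻¹ φ(c_{i+1})⁻¹`
  set x := T.phiCoeff i hi
  set y := T.actCoeff i hi γ₀
  set a : 𝓡.R := ((T.param ⟨i + 1, hi⟩).α : 𝓡.R)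
  set c : 𝓡.R := ((T.param ⟨i + 1, hi⟩).c γ₀ : 𝓡.R)
  set ia : 𝓡.R := (((T.param ⟨i + 1, hi⟩).α⁻¹ : 𝓡.Rˣ) : 𝓡.R)
  set ic : 𝓡.R := ((((T.param ⟨i + 1, hi⟩).c γ₀)⁻¹ : 𝓡.Rˣ) : 𝓡.R)
  set s : 𝓡.R := γ₀ • a
  set is' : 𝓡.R := (((𝓡.smulUnits γ₀ (T.param ⟨i + 1, hi⟩).α)⁻¹ : 𝓡.Rˣ) : 𝓡.R)
  set f : 𝓡.R := 𝓡.frob c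
  set if' : 𝓡.R := (((𝓡.frobUnits ((T.param ⟨i + 1, hi⟩).c γ₀))⁻¹ : 𝓡.Rˣ) : 𝓡.R)
  set X : 𝓡.R := γ₀ • x
  set Y : 𝓡.R := 𝓡.frob y
  set a0 : 𝓡.R := ((T.param ⟨i, Nat.lt_of_succ_lt hi⟩).α : 𝓡.R)
  set c0 : 𝓡.R := (((T.param ⟨i, Nat.lt_of_succ_lt hi⟩).c γ₀ : 𝓡.Rˣ) : 𝓡.R)
  linear_combination (-(ia * if')) * key + (x * ia - c0 * X * ic * is' - y * ic) * hf +
    (-(c0 * X * ic * is' * if' * f) - y * ic * if' * f) * ha + (c0 * X * ia * if' * ic * c) * hs +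
    (c0 * X * ia * if' + y * ia * if' * s) * hc +
    (-(c0 * X * ia * if' * ic * is') - y * ia * if' * ic) * hcompat

/-- **The class `c_i ∈ H¹_{φ,γ₀}(𝓡(δ_i δ_{i+1}⁻¹))` of the graded piece `(i, i+1)`** of the
triangulation (the extension class of `0 → 𝓡(δ_i) → Fil_{i+2}/Fil_i → 𝓡(δ_{i+1}) → 0` twisted by
`δ_{i+1}⁻¹`). [cite: Ding2019SimpleL, §3.1] -/
def gradedClass : (T.ratioParam i hi).toModule.H1 γ₀ :=
  Submodule.Quotient.mk ⟨T.gradedCocycle γ₀ i hi, T.gradedCocycle_mem_Z1 γ₀ i hi⟩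

/-- The graded piece `(i, i+1)` is **non-split**: its class `c_i` is non-zero (Ding's "`D_i^{i+1}`
non-split"; for a special ratio `δ_iδ_{i+1}⁻¹` this is the non-criticality input of the simple
`𝓛`-invariants).  (A predicate on `(T, γ₀, i)` — a definition, nothing asserted; binders
explicit so that the fact census does not read it as a closed statement.)
[cite: Ding2019SimpleL, §3.1] -/
def IsNonSplitAt (γ₀ : Γ) (i : ℕ) (hi : i + 1 < n) : Prop := T.gradedClass γ₀ i hi ≠ 0

end Graded

section Strict

variable [Module E D] [IsScalarTower E 𝓡.R D] (γ₀ : Γ) (i : Fin n)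

/-- `φ` of the twist `M(δ_i⁻¹)` induced on the quotient `D / Fil_i` (as an `E`-linear map).
[cite: KedlayaPottharstXiao2014, Def. 6.3.1] -/
def quotTwistPhi : (D ⧸ (T.Fil i).restrictScalars E) →ₗ[E] (D ⧸ (T.Fil i).restrictScalars E) :=
  ((T.Fil i).restrictScalars E).mapQ ((T.Fil i).restrictScalars E) (M.twist (T.param i)⁻¹).phiₗ
    fun v hv => ((T.isStable_Fil i).twist (T.param i)⁻¹).1 v hv

/-- `γ₀` of the twist `M(δ_i⁻¹)` induced on the quotient `D / Fil_i`. [cite: KedlayaPottharstXiao2014, Def. 6.3.1] -/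
def quotTwistAct : (D ⧸ (T.Fil i).restrictScalars E) →ₗ[E] (D ⧸ (T.Fil i).restrictScalars E) :=
  ((T.Fil i).restrictScalars E).mapQ ((T.Fil i).restrictScalars E)
    ((M.twist (T.param i)⁻¹).actₗ γ₀) fun v hv => ((T.isStable_Fil i).twist (T.param i)⁻¹).2 γ₀ v hv

/-- The triangulation is **strict at step `i`**: `H⁰_{φ,γ₀}((M / Fil_i)(δ_i⁻¹))` is free of rank one
over `E` (KPX: "one-dimensional", `X = Max L`), i.e. `Fil_{i+1}` is the unique `(φ, Γ)`-stable
enlargement of `Fil_i` with quotient `𝓡(δ_i)` (0-indexed `δ_i` = KPX's `δ_{i+1}`).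
(KPX Def. 6.3.1 is a DEFINITION: this is a predicate on `(T, γ₀, i)`, nothing is asserted —
it holds for some triangulations and fails for others; binders explicit so that the fact census
does not read it as a closed statement.) [cite: KedlayaPottharstXiao2014, Def. 6.3.1] -/
def IsStrictAt (γ₀ : Γ) (i : Fin n) : Prop :=
  Module.finrank E (Herr.H0 (T.quotTwistPhi i) (T.quotTwistAct γ₀ i)) = 1

/-- A **strict triangulation**: strict at every step (a predicate on `(T, γ₀)`; nothing
asserted). [cite: KedlayaPottharstXiao2014, Def. 6.3.1] -/
def IsStrict (γ₀ : Γ) : Prop := ∀ i : Fin n, T.IsStrictAt γ₀ i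

end Strict

section Transport

variable {E' : Type*} [CommRing E'] {𝓡' : PhiGammaRing Γ E'} {D' : Type*} [AddCommGroup D']
  [Module 𝓡'.R D'] {M' : PhiGammaModule 𝓡' D'}

/-- **Transport of triangulations along a map of coefficient rings** (e.g. "reduction modulo
`ε`" of a triangulated module over `𝓡_{E[ε]/ε²}` to one over `𝓡_E`, or base change
`𝓡_E → 𝓡_A`): `f : R → R'` commutes with `φ`, `Γ`, and carries the matrix entries of `φ` and of
every `γ` in the adapted basis of `T`, and the based parameters of `T`, to those of `T'`; i.e.
`(M', T')` is the based module `f_*(M, T)`. [cite: BellaicheChenevier2009, §2.3.1 (arXiv:math/0602340: `𝓡_A(δ) ⊗_A A/I = 𝓡_{A/I}(δ mod I)`)],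
[cite: Ding2019SimpleL, §3.3 (Thm. 3.4: `D = D_A|_z`, `δ_i = δ_{A,i}|_z`)] -/
def MapsAlong (f : 𝓡.R →+* 𝓡'.R) (hφ : ∀ r, f (𝓡.frob r) = 𝓡'.frob (f r))
    (hγ : ∀ (γ : Γ) r, f (γ • r) = γ • f r) (T' : M'.Triangulation n) : Prop :=
  (∀ i j : Fin n, f (T.basis.coord j (M.phi (T.basis i))) = T'.basis.coord j (M'.phi (T'.basis i))) ∧
  (∀ (γ : Γ) (i j : Fin n),
      f (T.basis.coord j (M.act γ (T.basis i))) = T'.basis.coord j (M'.act γ (T'.basis i))) ∧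
  ∀ i : Fin n, (T.param i).map f hφ hγ = T'.param i

end Transport

end Triangulation

end PhiGammaModule

/-! ### From the matrix picture of `Trianguline.lean` (`FramedPhiGammaModule`) to structures

`Trianguline.lean` records a free `(φ, Γ)`-module of rank `n` with a basis by its matrices
(`FramedPhiGammaModule 𝓡 n`: `matPhi ∈ GL_n(R)`, `matGamma γ ∈ GL_n(R)`), and a triangulation by
upper-triangular matrices with prescribed diagonals (`IsTriangularWith`).  The dictionary with the
structures of this file: the semilinear operators `phiOp`, `gammaOp` of a framed module ARE a
`PhiGammaModule` on `Rⁿ` (`toPhiGammaModule`; the action and commutation laws are the proved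
`gammaOp_mul`, `phiOp_gammaOp` of that file); a framed rank-one module gives a based rank-one datum
(`toRankOneDatum`: `α = det P = P₀₀`, `c_γ = det G(γ)`); and an upper-triangular framed module
with the diagonal of based data `d` gives a `Triangulation` of `toPhiGammaModule` in the standard
basis (`Triangulation.ofTriangular`), so that the graded classes, non-splitness and strictness of
Part 3 apply to the trianguline objects of `Trianguline.lean`. -/

namespace FramedPhiGammaModule

variable {Γ : Type u} [Group Γ] {E : Type v} [CommRing E] {𝓡 : PhiGammaRing.{u, v, w} Γ E} {n : ℕ}

/-- `φ` applied entrywise is `φ(r)`-homogeneous: `φ ∘ (r • x) = φ(r) • (φ ∘ x)`. [folklore] -/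
lemma frob_comp_smul (r : 𝓡.R) (x : Fin n → 𝓡.R) :
    (𝓡.frob ∘ (r • x) : Fin n → 𝓡.R) = 𝓡.frob r • (𝓡.frob ∘ x) := by
  ext i
  simp [smul_eq_mul]

/-- `γ` applied entrywise is `γ(r)`-homogeneous: `γ • (r • x) = γ(r) • (γ • x)`. [folklore] -/
lemma smul_smul_pi (γ : Γ) (r : 𝓡.R) (x : Fin n → 𝓡.R) :
    γ • (r • x) = (γ • r) • (γ • x) := by
  ext i
  simp [smul_eq_mul, smul_mul']

/-- **A framed `(φ, Γ)`-module is a `(φ, Γ)`-module structure on `Rⁿ`**: `φ_D = phiOp`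
(`x ↦ P φ(x)`), `γ ↦ gammaOp γ` (`x ↦ G(γ) γ(x)`); the axioms are `gammaOp_mul`, `phiOp_gammaOp`
of `Trianguline.lean` and the semilinearity of `*ᵥ`. [cite: KedlayaPottharstXiao2014, Def. 2.2.12] -/
def toPhiGammaModule (D : FramedPhiGammaModule 𝓡 n) : PhiGammaModule 𝓡 (Fin n → 𝓡.R) where
  phi :=
    { toFun := D.phiOp
      map_zero' := by
        simp only [phiOp]
        rw [show (𝓡.frob ∘ (0 : Fin n → 𝓡.R) : Fin n → 𝓡.R) = 0 from funext fun _ => map_zero _,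
          Matrix.mulVec_zero]
      map_add' := fun x y => by
        simp only [phiOp]
        rw [show (𝓡.frob ∘ (x + y) : Fin n → 𝓡.R) = 𝓡.frob ∘ x + 𝓡.frob ∘ y from
          funext fun _ => map_add _ _ _, Matrix.mulVec_add] }
  phi_smul r x := by
    simp only [AddMonoidHom.coe_mk, ZeroHom.coe_mk, phiOp, frob_comp_smul, Matrix.mulVec_smul]
  act γ :=
    { toFun := D.gammaOp γ
      map_zero' := by simp only [gammaOp, smul_zero, Matrix.mulVec_zero]
      map_add' := fun x y => by simp only [gammaOp, smul_add, Matrix.mulVec_add] }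
  act_one := AddMonoidHom.ext fun x => by
    simp [gammaOp, D.matGamma_one]
  act_mul γ γ' := AddMonoidHom.ext fun x => D.gammaOp_mul γ γ' x
  act_smul γ r x := by
    simp only [AddMonoidHom.coe_mk, ZeroHom.coe_mk, gammaOp, smul_smul_pi, Matrix.mulVec_smul]
  phi_act γ x := D.phiOp_gammaOp γ x

/-- Unfolding lemma: `φ_D` of `toPhiGammaModule` is `phiOp`. [folklore] -/
@[simp] lemma toPhiGammaModule_phi_apply (D : FramedPhiGammaModule 𝓡 n) (x : Fin n → 𝓡.R) :
    D.toPhiGammaModule.phi x = D.phiOp x := rfl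

/-- Unfolding lemma: `γ` of `toPhiGammaModule` is `gammaOp γ`. [folklore] -/
@[simp] lemma toPhiGammaModule_act_apply (D : FramedPhiGammaModule 𝓡 n) (γ : Γ)
    (x : Fin n → 𝓡.R) : D.toPhiGammaModule.act γ x = D.gammaOp γ x := rfl

/-- `φ_D(e_i)` is the `i`-th column of `P`. [folklore] -/
lemma phiOp_single (D : FramedPhiGammaModule 𝓡 n) (i j : Fin n) :
    D.phiOp (Pi.single i 1) j = (D.matPhi : Matrix (Fin n) (Fin n) 𝓡.R) j i := by
  have h : (𝓡.frob ∘ (Pi.single i 1 : Fin n → 𝓡.R) : Fin n → 𝓡.R) = Pi.single i 1 := by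
    ext k
    by_cases hk : k = i
    · subst hk; simp
    · simp [hk]
  rw [phiOp, h]
  simp [Matrix.mulVec, dotProduct, Pi.single_apply]

/-- `γ(e_i)` is the `i`-th column of `G(γ)`. [folklore] -/
lemma gammaOp_single (D : FramedPhiGammaModule 𝓡 n) (γ : Γ) (i j : Fin n) :
    D.gammaOp γ (Pi.single i 1) j = (D.matGamma γ : Matrix (Fin n) (Fin n) 𝓡.R) j i := by
  have h : (γ • (Pi.single i 1 : Fin n → 𝓡.R)) = Pi.single i 1 := by
    ext k
    by_cases hk : k = i
    · subst hk; simp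
    · simp [hk]
  rw [gammaOp, h]
  simp [Matrix.mulVec, dotProduct, Pi.single_apply]

/-- The determinant of `γ` applied entrywise is `γ` of the determinant. [folklore] -/
lemma det_gammaGL (γ : Γ) {m : ℕ} (U : GL (Fin m) 𝓡.R) :
    (Matrix.GeneralLinearGroup.det (𝓡.gammaGL m γ U) : 𝓡.R) =
      γ • (Matrix.GeneralLinearGroup.det U : 𝓡.R) := by
  rw [Matrix.GeneralLinearGroup.val_det_apply, Matrix.GeneralLinearGroup.val_det_apply,
    PhiGammaRing.coe_gammaGL, ← RingHom.mapMatrix_apply, ← RingHom.map_det]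
  rfl

/-- The determinant of `φ` applied entrywise is `φ` of the determinant. [folklore] -/
lemma det_phiGL {m : ℕ} (U : GL (Fin m) 𝓡.R) :
    (Matrix.GeneralLinearGroup.det (𝓡.phiGL m U) : 𝓡.R) =
      𝓡.frob (Matrix.GeneralLinearGroup.det U : 𝓡.R) := by
  rw [Matrix.GeneralLinearGroup.val_det_apply, Matrix.GeneralLinearGroup.val_det_apply,
    PhiGammaRing.coe_phiGL]
  change ((𝓡.frob : 𝓡.R →+* 𝓡.R).mapMatrix (U : Matrix (Fin m) (Fin m) 𝓡.R)).det = _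
  rw [← RingHom.map_det]
  rfl

/-- **A framed rank-one module as a based rank-one datum**: `α = det P (= P₀₀ = phiScalar)`,
`c_γ = det G(γ) (= gammaScalar γ)`; the crossed-homomorphism and commutation relations are the
determinants of `matGamma_mul` and `matPhi_mul`. [cite: KedlayaPottharstXiao2014, Notation 6.2.2, Construction 6.2.4] -/
def toRankOneDatum (L : FramedPhiGammaModule 𝓡 1) : 𝓡.RankOneDatum where
  α := Matrix.GeneralLinearGroup.det L.matPhi
  c γ := Matrix.GeneralLinearGroup.det (L.matGamma γ)
  c_mul γ γ' := by
    rw [L.matGamma_mul, map_mul, Units.val_mul, det_gammaGL]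
  compat γ := by
    have h := congrArg (fun U : GL (Fin 1) 𝓡.R => (Matrix.GeneralLinearGroup.det U : 𝓡.R))
      (L.matPhi_mul γ)
    simp only [map_mul, Units.val_mul, det_gammaGL, det_phiGL] at h
    linear_combination -h

/-- `α` of `toRankOneDatum` is the scalar `phiScalar = P₀₀` of `Trianguline.lean`. [folklore] -/
lemma toRankOneDatum_α (L : FramedPhiGammaModule 𝓡 1) : (L.toRankOneDatum.α : 𝓡.R) = L.phiScalar := by
  show (Matrix.GeneralLinearGroup.det L.matPhi : 𝓡.R) = _
  rw [Matrix.GeneralLinearGroup.val_det_apply, Matrix.det_fin_one]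
  rfl

/-- `c_γ` of `toRankOneDatum` is the scalar `gammaScalar γ = G(γ)₀₀` of `Trianguline.lean`. [folklore] -/
lemma toRankOneDatum_c (L : FramedPhiGammaModule 𝓡 1) (γ : Γ) :
    (L.toRankOneDatum.c γ : 𝓡.R) = L.gammaScalar γ := by
  show (Matrix.GeneralLinearGroup.det (L.matGamma γ) : 𝓡.R) = _
  rw [Matrix.GeneralLinearGroup.val_det_apply, Matrix.det_fin_one]
  rfl

end FramedPhiGammaModule

namespace PhiGammaModule.Triangulation

variable {Γ : Type u} [Group Γ] {E : Type v} [CommRing E] {𝓡 : PhiGammaRing.{u, v, w} Γ E} {n : ℕ}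

/-- For the standard basis of `Rⁿ`, the coordinate `e_j^*` is evaluation at `j`. [folklore] -/
lemma basisFun_coord_apply (j : Fin n) (x : Fin n → 𝓡.R) : (Pi.basisFun 𝓡.R (Fin n)).coord j x = x j := by
  simp [Module.Basis.coord_apply]

/-- **An upper-triangular framed module is triangulated** (in the standard basis): if the matrices
of `φ` and of every `γ` are upper triangular (`IsTriangularWith`) with diagonal the scalars
`(α_i, c_i)` of based rank-one data `d_i`, then `fil (e) k = ⟨e_0, …, e_{k-1}⟩` is a
triangulation of `toPhiGammaModule` with parameters `d` (the dictionary between Hansen's /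
`Trianguline.lean`'s "upper triangular with prescribed diagonal" and KPX's filtrations).
[cite: KedlayaPottharstXiao2014, Def. 6.3.1], [cite: HansenUniversalEigenvarieties2017, Def. 6.1.1] -/
def ofTriangular (D : FramedPhiGammaModule 𝓡 n) (d : Fin n → 𝓡.RankOneDatum)
    (hD : D.IsTriangularWith (fun i => ((d i).α : 𝓡.R)) (fun i γ => ((d i).c γ : 𝓡.R))) :
    D.toPhiGammaModule.Triangulation n where
  basis := Pi.basisFun 𝓡.R (Fin n)
  param := d
  phi_basis i := by
    rw [mem_fil_iff]
    intro j hj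
    rw [map_sub, map_smul, basisFun_coord_apply, basisFun_coord_apply, Pi.basisFun_apply,
      FramedPhiGammaModule.toPhiGammaModule_phi_apply, FramedPhiGammaModule.phiOp_single]
    rcases lt_or_eq_of_le hj with hlt | heq
    · rw [hD.1 hlt, Pi.single_eq_of_ne' (Fin.ne_of_lt hlt), smul_zero, sub_zero]
    · have hji : j = i := (Fin.ext heq).symm
      subst hji
      rw [hD.2.1 j, Pi.single_eq_same, smul_eq_mul, mul_one, sub_self]
  act_basis γ i := by
    rw [mem_fil_iff]
    intro j hj
    rw [map_sub, map_smul, basisFun_coord_apply, basisFun_coord_apply, Pi.basisFun_apply,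
      FramedPhiGammaModule.toPhiGammaModule_act_apply, FramedPhiGammaModule.gammaOp_single]
    rcases lt_or_eq_of_le hj with hlt | heq
    · rw [(hD.2.2 γ).1 hlt, Pi.single_eq_of_ne' (Fin.ne_of_lt hlt), smul_zero, sub_zero]
    · have hji : j = i := (Fin.ext heq).symm
      subst hji
      rw [(hD.2.2 γ).2 j, Pi.single_eq_same, smul_eq_mul, mul_one, sub_self]

/-- The parameters of `ofTriangular` are the given data. [folklore] -/
@[simp] lemma ofTriangular_param (D : FramedPhiGammaModule 𝓡 n) (d : Fin n → 𝓡.RankOneDatum)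
    (hD : D.IsTriangularWith (fun i => ((d i).α : 𝓡.R)) (fun i γ => ((d i).c γ : 𝓡.R))) (i : Fin n) :
    (ofTriangular D d hD).param i = d i := rfl

end PhiGammaModule.Triangulation

/-! ## Part 4. The `(φ, Γ_F)`-module theory over the Robba ring `𝓡_E(π_F)`: the enriched datum

`Trianguline.lean` fixes the datum `PhiGammaModuleData p F E`: a `(φ, Γ)`-ring for
`Γ_F^abs = Field.absoluteGaloisGroup F` acting through its cyclotomic quotient `Γ_F` (intended:
`𝓡_E(π_F) = 𝓡_{E,F}`, [cite: KedlayaPottharstXiao2014, Def. 2.2.2]), `Drig` (framed) and the framed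
rank-one objects `charMod δ = 𝓡_E(π_F)(δ)` with their classification axioms.  The requests of item
`defn-PhiGammaModuleRobba` beyond that datum need: the topology of `𝓡_E(π_F)` and the continuity of
the actions [cite: KedlayaPottharstXiao2014, Def. 2.2.12]; a lift `gen` of a topological generator
`γ_F` of `Γ_F/Δ_F`, `Δ_F` the `p`-torsion of `Γ_F` [cite: KedlayaPottharstXiao2014, Notation 2.3.1],
to form KPX's Herr complexes `C^•_{φ,γ_F}(M^{Δ_F})`; the local-class-field-theory map
`Hom(Fˣ, E) → H¹_{φ,γ_F}(𝓡_E(π_F))` [cite: Ding2019SimpleL, §3.1]; and the predicate "étale"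
(pure of slope `0`, Kedlaya) for the `D_rig` correspondence.  `PhiGammaModuleRobba p F E` EXTENDS
`PhiGammaModuleData p F E` by exactly these fields (as that file prescribes: "facts needing more
structure are to be stated for structures extending this one"), and the theorems of the theory are
predicates on the enriched datum (nothing asserted): `HasLiuFiniteness d` (Liu: finiteness and
Euler characteristic `-d·n`, `d = [F:ℚ_p]`; Tate duality is not rendered — it needs duals),
`HasRankOneCohomology d` (KPX Prop. 6.2.8 / Nakamura), `HasRankOneClassification` (KPX Thm. 6.2.14
for ALL continuous rank-one objects, and multiplicativity of `δ ↦ 𝓡(δ)`), `HasCFTIdentification`,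
`HasDrigEtale` (`D_rig` lands in, and exhausts, the étale objects), their conjunction `IsKPX d`.
Invariants are taken under `torsionKernel p F = χ_cyc⁻¹(p-torsion of ℤ_pˣ) ⊇ H_F`, so that
`M^{torsionKernel} = M^{Δ_F}` for modules on which `H_F` acts trivially (all modules of the datum). -/

section Robba

open PhiGammaModule

variable (p : ℕ) [Fact p.Prime] (F : Type u) [Field F]

/-- The subgroup `χ_cyc⁻¹((ℤ_pˣ)[p^∞]) ⊆ Γ_F^abs`: the elements whose cyclotomic character is
`p`-power torsion.  It contains `H_F = ker χ_cyc` and its image in `Γ_F = Γ_F^abs/H_F ↪ ℤ_pˣ` is the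
`p`-torsion subgroup `Δ_F` of KPX (trivial for `p ≠ 2`, of order `≤ 2` for `p = 2`); invariants under
it are the `Δ_F`-invariants of a module on which `H_F` acts trivially.
[cite: KedlayaPottharstXiao2014, Notation 2.3.1] -/
def torsionKernel : Subgroup (Field.absoluteGaloisGroup F) :=
  (CommGroup.primaryComponent (ℤ_[p]ˣ) p).comap (GaloisRep.cyclotomicCharacter F p).toMonoidHom

/-- Membership in `torsionKernel`: `χ_cyc(σ)^{p^k} = 1` for some `k`. [folklore] -/
lemma mem_torsionKernel_iff (σ : Field.absoluteGaloisGroup F) :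
    σ ∈ torsionKernel p F ↔ ∃ k : ℕ, GaloisRep.cyclotomicCharacter F p σ ^ p ^ k = 1 := by
  simp [torsionKernel, CommGroup.mem_primaryComponent]

/-- `H_F = ker χ_cyc ⊆ torsionKernel`. [folklore] -/
lemma mem_torsionKernel_of_eq_one {σ : Field.absoluteGaloisGroup F}
    (h : GaloisRep.cyclotomicCharacter F p σ = 1) : σ ∈ torsionKernel p F :=
  (mem_torsionKernel_iff p F σ).2 ⟨0, by simp [h]⟩

/-- `torsionKernel` is a normal subgroup (a preimage of a subgroup of an abelian group), so it is
normalised by every `γ₀`. [folklore] -/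
lemma conj_mem_torsionKernel (γ₀ : Field.absoluteGaloisGroup F) :
    ∀ δ ∈ (torsionKernel p F : Set (Field.absoluteGaloisGroup F)), γ₀⁻¹ * δ * γ₀ ∈
      (torsionKernel p F : Set (Field.absoluteGaloisGroup F)) := by
  intro δ hδ
  have hn : (torsionKernel p F).Normal := by unfold torsionKernel; infer_instance
  simpa using hn.conj_mem δ hδ γ₀⁻¹

variable [TopologicalSpace F] (E : Type v) [Field E] [TopologicalSpace E] [IsTopologicalRing E]

/-- `Hom(Fˣ, E)`: the `E`-vector space of **continuous additive characters** `ψ : Fˣ → E`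
(`ψ(ab) = ψ(a) + ψ(b)`), of dimension `[F:ℚ_p] + 1` for `F/ℚ_p` finite.
[cite: Ding2019SimpleL, §1 (Notation) and §3.1] -/
def HomCont : Submodule E (Fˣ → E) where
  carrier := {ψ | Continuous ψ ∧ ∀ a b : Fˣ, ψ (a * b) = ψ a + ψ b}
  add_mem' := fun {ψ ψ'} hψ hψ' =>
    ⟨hψ.1.add hψ'.1, fun a b => by simp only [Pi.add_apply, hψ.2, hψ'.2]; abel⟩
  zero_mem' := ⟨continuous_const, fun a b => by simp⟩
  smul_mem' := fun e ψ hψ =>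
    ⟨continuous_const.mul hψ.1, fun a b => by simp only [Pi.smul_apply, smul_eq_mul, hψ.2, mul_add]⟩

/-- Membership in `Hom(Fˣ, E)`. [folklore] -/
lemma mem_HomCont_iff (ψ : Fˣ → E) :
    ψ ∈ HomCont F E ↔ Continuous ψ ∧ ∀ a b : Fˣ, ψ (a * b) = ψ a + ψ b := Iff.rfl

/-- **The `(φ, Γ_F)`-module theory over the Robba ring `𝓡_E(π_F)`, enriched datum**: the datum
`PhiGammaModuleData p F E` of `Trianguline.lean` (ring `𝓡_E(π_F)` with `φ` and `Γ_F^abs` acting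
through `Γ_F`, framed `Drig`, framed `charMod δ = 𝓡_E(π_F)(δ)` and their axioms) EXTENDED by: the
topology of `𝓡_E(π_F)` and the continuity of `φ`, of each `σ` and of the orbit maps (KPX
Def. 2.2.12: continuous `Γ_K`-action); an element `gen` of `Γ_F^abs` whose image topologically
generates `Γ_F/Δ_F` (`dense_gen`, KPX Notation 2.3.1: `γ_K`); the local-class-field-theory map
`homToH1 : Hom(Fˣ, E) → H¹_{φ,γ_F}(𝓡_E(π_F))` (Herr complex on the `torsionKernel`-invariants,
i.e. on `𝓡^{Δ_F}`); and the predicate `IsEtale` ("pure of slope `0`", Kedlaya) on framed modules.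
No theorem is a field; see `HasLiuFiniteness`, `HasRankOneCohomology`, `HasRankOneClassification`,
`HasCFTIdentification`, `HasDrigEtale`.
[cite: KedlayaPottharstXiao2014, Def. 2.2.12, Notation 2.3.1, Def. 2.3.3], [cite: Ding2019SimpleL, §3.1] -/
structure PhiGammaModuleRobba extends PhiGammaModuleData.{u, v, w} p F E where
  /-- The topology of `𝓡_E(π_F)` (an LF-space). -/
  [topR : TopologicalSpace ring.R]
  [topRingR : IsTopologicalRing ring.R]
  /-- `φ` is continuous. -/
  continuous_frob : Continuous ring.frob
  /-- Each `σ ∈ Γ_F^abs` acts continuously on `𝓡_E(π_F)`. -/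
  continuous_act : ∀ σ : Field.absoluteGaloisGroup F, Continuous fun r : ring.R => σ • r
  /-- The action is continuous in `σ` (orbit maps, Krull topology). -/
  continuous_orbit : ∀ r : ring.R, Continuous fun σ : Field.absoluteGaloisGroup F => σ • r
  /-- A lift `γ_F ∈ Γ_F^abs` of a topological generator of `Γ_F/Δ_F`. -/
  gen : Field.absoluteGaloisGroup F
  /-- `⟨gen⟩ · χ_cyc⁻¹(Δ_F)` is dense in `Γ_F^abs`, i.e. the image of `gen` topologically generates
  `Γ_F / Δ_F`. -/
  dense_gen : Dense ((Subgroup.closure {gen} ⊔ torsionKernel p F :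
    Subgroup (Field.absoluteGaloisGroup F)) : Set (Field.absoluteGaloisGroup F))
  /-- The local-class-field-theory map `Hom(Fˣ, E) → H¹_{φ,γ_F}(𝓡_E(π_F))`
  (`Hom(Fˣ, E) ≅ Hom(G_F, E) = H¹(G_F, E) ≅ H¹_{φ,γ_F}(𝓡_E)`). -/
  homToH1 : HomCont F E →ₗ[E]
    (PhiGammaModule.unit ring).HΔ1 gen (torsionKernel p F : Set (Field.absoluteGaloisGroup F))
      (conj_mem_torsionKernel p F gen)
  /-- "Étale" = pure of slope zero (Kedlaya), an abstract predicate on framed modules. -/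
  IsEtale : {n : ℕ} → FramedPhiGammaModule ring n → Prop

attribute [instance] PhiGammaModuleRobba.topR PhiGammaModuleRobba.topRingR

namespace PhiGammaModuleRobba

variable {p F E} (𝓣 : PhiGammaModuleRobba.{u, v, w} p F E)

/-- The Robba ring `𝓡_E(π_F)` of the datum. [cite: KedlayaPottharstXiao2014, Def. 2.2.2] -/
abbrev R : Type w := 𝓣.ring.R

section Cohomology

variable {D : Type x} [AddCommGroup D] [Module 𝓣.R D] [Module E D] [IsScalarTower E 𝓣.R D]
  (M : PhiGammaModule 𝓣.ring D)

/-- KPX's `H⁰_{φ,γ_F}(M)` (Herr complex on `M^{Δ_F}`, for `M` with trivial `H_F`-action).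
[cite: KedlayaPottharstXiao2014, Def. 2.3.3] -/
abbrev H0 : Submodule E (M.invariants (torsionKernel p F : Set (Field.absoluteGaloisGroup F))) :=
  M.HΔ0 𝓣.gen _ (conj_mem_torsionKernel p F 𝓣.gen)

/-- KPX's `H¹_{φ,γ_F}(M)`. [cite: KedlayaPottharstXiao2014, Def. 2.3.3] -/
abbrev H1 : Type x := M.HΔ1 𝓣.gen _ (conj_mem_torsionKernel p F 𝓣.gen)

/-- KPX's `H²_{φ,γ_F}(M)`. [cite: KedlayaPottharstXiao2014, Def. 2.3.3] -/
abbrev H2 : Type x := M.HΔ2 𝓣.gen _ (conj_mem_torsionKernel p F 𝓣.gen)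

/-- From KPX's `H¹` to the `H¹` of the full Herr complex of `(φ, gen)` on `M`, where the cup product
and the graded classes of Part 2–3 live (`HΔ1toH1`). [cite: KedlayaPottharstXiao2014, Def. 2.3.3] -/
abbrev H1toH1 : 𝓣.H1 M →ₗ[E] M.H1 𝓣.gen :=
  M.HΔ1toH1 𝓣.gen _ (conj_mem_torsionKernel p F 𝓣.gen)

end Cohomology

/-- A framed module of the datum is a **`(φ, Γ_F)`-module** when `H_F = ker χ_cyc` acts on it by the
identity matrices (the action is through `Γ_F`; automatic for `Drig ρ` and `charMod δ` by the axioms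
`Drig_matGamma_eq_one`, `charMod_matGamma_eq_one` of `Trianguline.lean`).
[cite: KedlayaPottharstXiao2014, Notation 2.2.1, Def. 2.2.12] -/
def IsCyclotomic {n : ℕ} (D : FramedPhiGammaModule 𝓣.ring n) : Prop :=
  ∀ σ : Field.absoluteGaloisGroup F, GaloisRep.cyclotomicCharacter F p σ = 1 → D.matGamma σ = 1

/-- The based rank-one datum of `𝓡_E(π_F)(δ)` (`α = a_δ`, `c_σ = c_δ(σ)` of `Trianguline.lean`).
[cite: KedlayaPottharstXiao2014, Construction 6.2.4] -/
abbrev ofChar (δ : Fˣ →ₜ* Eˣ) : 𝓣.ring.RankOneDatum := (𝓣.charMod δ).toRankOneDatum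

/-- `ρ` is **strictly trianguline with ordered parameters `δ`**: in some basis `D_rig(ρ)` is upper
triangular with the scalars of `𝓡(δ_0), …, 𝓡(δ_{n-1})` on the diagonal (`IsTriangulineWith` of
`Trianguline.lean`) AND the resulting triangulation is strict at every step (KPX:
`dim_E H⁰((M/Fil_i)(δ_i⁻¹)) = 1`; then it is the unique triangulation with these parameters).
[cite: KedlayaPottharstXiao2014, Def. 6.3.1] -/
def IsStrictTriangulineRep {n : ℕ} (ρ : FramedGaloisRep F E n) (δ : Fin n → (Fˣ →ₜ* Eˣ)) : Prop :=
  ∃ (U : GL (Fin n) 𝓣.R) (h : ((𝓣.Drig ρ).conj U).IsTriangularWith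
      (fun i => ((𝓣.ofChar (δ i)).α : 𝓣.R)) (fun i σ => ((𝓣.ofChar (δ i)).c σ : 𝓣.R))),
    (Triangulation.ofTriangular _ (fun i => 𝓣.ofChar (δ i)) h).IsStrict 𝓣.gen

/-- The data `(a_δ, c_δ)` of `Trianguline.lean` are the scalars of `ofChar δ`; hence
`IsTriangulineWith` of that file is upper-triangularity with the diagonal of `ofChar ∘ δ`. [folklore] -/
lemma isTriangulineWith_iff {n : ℕ} (D : FramedPhiGammaModule 𝓣.ring n) (δ : Fin n → (Fˣ →ₜ* Eˣ)) :
    𝓣.toPhiGammaModuleData.IsTriangulineWith D δ ↔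
      ∃ U : GL (Fin n) 𝓣.R, (D.conj U).IsTriangularWith
        (fun i => ((𝓣.ofChar (δ i)).α : 𝓣.R)) (fun i σ => ((𝓣.ofChar (δ i)).c σ : 𝓣.R)) := by
  simp only [PhiGammaModuleData.IsTriangulineWith, FramedPhiGammaModule.IsTriangulableWith,
    PhiGammaModuleData.charPhi, PhiGammaModuleData.charGamma, ofChar,
    FramedPhiGammaModule.toRankOneDatum_α, FramedPhiGammaModule.toRankOneDatum_c]

/-- A strictly trianguline representation is trianguline with the same parameters (in the sense
of `Trianguline.lean`). [folklore] -/
lemma IsStrictTriangulineRep.isTriangulineWith {n : ℕ} {ρ : FramedGaloisRep F E n}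
    {δ : Fin n → (Fˣ →ₜ* Eˣ)} (h : 𝓣.IsStrictTriangulineRep ρ δ) :
    ρ.IsTriangulineWith 𝓣.toPhiGammaModuleData δ := by
  obtain ⟨U, hU, -⟩ := h
  exact (𝓣.isTriangulineWith_iff (𝓣.Drig ρ) δ).2 ⟨U, hU⟩

/-! ### The theorems of the theory, as predicates on the enriched datum -/

/-- **Liu's theorem (finiteness and Euler characteristic)** for the datum, `d = [F:ℚ_p]`: for every
framed `(φ, Γ_F)`-module `D` (trivial `H_F`-action) with continuous `Γ_F`-action,
`H^i_{φ,γ_F}(D)` is finite-dimensional over `E` for `i = 0, 1, 2` and `Σ (-1)^i dim H^i = -d·n`.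
(Liu's Tate duality `H^i × H^{2-i}(D^*) → E` is not rendered here.)
[cite: KedlayaPottharstXiao2014, Thm. 2.3.11 (Liu) (1)–(2)] -/
def HasLiuFiniteness (d : ℕ) : Prop :=
  ∀ (n : ℕ) (D : FramedPhiGammaModule 𝓣.ring n), 𝓣.IsCyclotomic D → D.toPhiGammaModule.IsContinuous →
    FiniteDimensional E (𝓣.H0 D.toPhiGammaModule) ∧ FiniteDimensional E (𝓣.H1 D.toPhiGammaModule) ∧
      FiniteDimensional E (𝓣.H2 D.toPhiGammaModule) ∧
        (Module.finrank E (𝓣.H0 D.toPhiGammaModule) : ℤ) - Module.finrank E (𝓣.H1 D.toPhiGammaModule) +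
            Module.finrank E (𝓣.H2 D.toPhiGammaModule) = -((d * n : ℕ) : ℤ)

/-- **Cohomology of rank-one objects** (`d = [F:ℚ_p]`): `dim_E H¹_{φ,γ_F}(𝓡_E(π_F)(δ)) = d`, unless
`H⁰` or `H²` is non-zero, in which case it is `d + 1`; and `dim_E H⁰(𝓡_E(π_F)) = 1`.
[cite: KedlayaPottharstXiao2014, Prop. 6.2.8], [cite: Nakamura2009, Thm. 1.3 (arXiv:0801.1230 numbering)],
[cite: Ding2019SimpleL, §3.1] -/
def HasRankOneCohomology (d : ℕ) : Prop :=
  Module.finrank E (𝓣.H0 (PhiGammaModule.unit 𝓣.ring)) = 1 ∧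
  ∀ δ : Fˣ →ₜ* Eˣ,
    Module.finrank E (𝓣.H1 (𝓣.charMod δ).toPhiGammaModule) =
      d + (if Module.finrank E (𝓣.H0 (𝓣.charMod δ).toPhiGammaModule) = 0 ∧
            Module.finrank E (𝓣.H2 (𝓣.charMod δ).toPhiGammaModule) = 0 then 0 else 1)

/-- **Classification of rank-one objects** (KPX Thm. 6.2.14 over `X = Max E`, answering Bellaïche;
Colmez for `F = ℚ_p`; Nakamura via `B`-pairs): `δ ↦ 𝓡_E(π_F)(δ)` is multiplicative up to
isomorphism, the `𝓡(δ)` are continuous `(φ, Γ_F)`-modules, and EVERY framed rank-one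
`(φ, Γ_F)`-module with continuous action is `≅ 𝓡(δ)` for a unique `δ` (uniqueness is already the
axiom `charMod_injective` of `Trianguline.lean`; existence there is only `Drig_rank_one`).
[cite: KedlayaPottharstXiao2014, Construction 6.2.4, Thm. 6.2.14],
[cite: BellaicheChenevier2009, Prop. 2.3.1 (arXiv:math/0602340 numbering)],
[cite: Nakamura2009, Thm. 1.1 (arXiv:0801.1230 numbering)]
(A predicate ON the datum `𝓣` — a hypothesis a route may posit, nothing asserted; binder
explicit so that the fact census does not read it as a closed statement.) -/
def HasRankOneClassification (𝓣 : PhiGammaModuleRobba.{u, v, w} p F E) : Prop :=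
  (∀ δ δ' : Fˣ →ₜ* Eˣ, (𝓣.ofChar (δ * δ')).IsEquiv (𝓣.ofChar δ * 𝓣.ofChar δ')) ∧
  (∀ δ : Fˣ →ₜ* Eˣ, (𝓣.charMod δ).toPhiGammaModule.IsContinuous) ∧
  ∀ L : FramedPhiGammaModule 𝓣.ring 1, 𝓣.IsCyclotomic L → L.toPhiGammaModule.IsContinuous →
    ∃! δ : Fˣ →ₜ* Eˣ, L.IsIso (𝓣.charMod δ)

/-- **The local-class-field-theory identification** `Hom(Fˣ, E) ≅ H¹_{φ,γ_F}(𝓡_E(π_F))`: the map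
`homToH1` of the datum is bijective. [cite: Ding2019SimpleL, §3.1],
[cite: KedlayaPottharstXiao2014, Prop. 2.3.7, Prop. 6.2.8]
(A predicate ON the datum `𝓣`, nothing asserted; binder explicit for the fact census.) -/
def HasCFTIdentification (𝓣 : PhiGammaModuleRobba.{u, v, w} p F E) : Prop :=
  Function.Bijective 𝓣.homToH1

/-- **`D_rig` and étale objects** (Fontaine, Cherbonnier–Colmez, Kedlaya; Berger–Colmez, Kedlaya–Liu
in families): `D_rig(ρ)` has continuous `Γ_F`-action and is étale (pure of slope `0`), and every
étale framed `(φ, Γ_F)`-module with continuous action is `≅ D_rig(ρ)` for some `ρ` (essential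
surjectivity onto étale objects — Kedlaya's slope filtration theorem; full faithfulness is the
axiom `Drig_injective` of `Trianguline.lean`). [cite: KedlayaPottharstXiao2014, Thm. 2.2.17, Remark 2.2.16],
[cite: BellaicheChenevier2009, §2.2.4–2.2.5, Prop. 2.2.6 (arXiv:math/0602340 numbering)]
(A predicate ON the datum `𝓣`, nothing asserted; binder explicit for the fact census.) -/
def HasDrigEtale (𝓣 : PhiGammaModuleRobba.{u, v, w} p F E) : Prop :=
  (∀ (n : ℕ) (ρ : FramedGaloisRep F E n),
      (𝓣.Drig ρ).toPhiGammaModule.IsContinuous ∧ 𝓣.IsEtale (𝓣.Drig ρ)) ∧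
  (∀ (n : ℕ) (D D' : FramedPhiGammaModule 𝓣.ring n), D.IsIso D' → (𝓣.IsEtale D ↔ 𝓣.IsEtale D')) ∧
  ∀ (n : ℕ) (D : FramedPhiGammaModule 𝓣.ring n), 𝓣.IsCyclotomic D → D.toPhiGammaModule.IsContinuous →
    𝓣.IsEtale D → ∃ ρ : FramedGaloisRep F E n, (𝓣.Drig ρ).IsIso D

/-- The conjunction a route posits when it assumes "the" `(φ, Γ_F)`-module theory over `𝓡_E(π_F)`
with `[F:ℚ_p] = d`, on top of the axioms of `PhiGammaModuleData`.
[cite: KedlayaPottharstXiao2014, Thm. 2.2.17, Thm. 2.3.11, Prop. 6.2.8, Thm. 6.2.14] -/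
def IsKPX (d : ℕ) : Prop :=
  𝓣.HasLiuFiniteness d ∧ 𝓣.HasRankOneCohomology d ∧ 𝓣.HasRankOneClassification ∧
    𝓣.HasCFTIdentification ∧ 𝓣.HasDrigEtale

/-! ### Relative rank-one objects (`𝓡_A(π_F)(δ_A)`, `A` a finite `E`-algebra) -/

/-- **Relative rank-one data** on top of the enriched datum: KPX's Construction 6.2.4 over a finite
`E`-algebra `A` (for which `𝓡_A(π_F) = A ⊗_E 𝓡_E(π_F) = (ring.baseChange A).R`), i.e. based rank-one
`(φ, Γ_F)`-modules `𝓡_A(π_F)(δ_A)` of continuous characters `δ_A : Fˣ → Aˣ` — the objects of the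
first-order deformations in the Colmez–Greenberg–Stevens formula (`A = E[ε]/ε²`).  A further
datum (no theorem is a field); its compatibilities with `charMod`/`ofChar` and with change of `A`
are the predicate `IsCompatible`. [cite: KedlayaPottharstXiao2014, Construction 6.2.4],
[cite: Ding2019SimpleL, §3.3] -/
structure RelativeCharData where
  /-- `δ_A ↦ 𝓡_A(π_F)(δ_A)` with a chosen basis, over `A ⊗_E 𝓡_E(π_F)`. -/
  ofCharOver : (A : Type v) → [CommRing A] → [Algebra E A] → [TopologicalSpace A] →
    [IsTopologicalRing A] → [Module.Finite E A] → [Nontrivial A] →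
    (Fˣ →ₜ* Aˣ) → (𝓣.ring.baseChange A).RankOneDatum

namespace RelativeCharData

variable {𝓣} (𝓒 : 𝓣.RelativeCharData)

/-- **Compatibility of the relative rank-one objects** (KPX Construction 6.2.4 is tensor-functorial
and commutes with base change; Bellaïche–Chenevier: `𝓡_A(δ) ⊗_A A/I ≅ 𝓡_{A/I}(δ mod I)`): over
`A = E` the relative objects are the base change of `ofChar`; along a continuous `E`-algebra map
`σ : A → B` the datum of `δ_A` is transported to that of `σ ∘ δ_A` (up to isomorphism); and
`δ_A ↦ 𝓡_A(δ_A)` is multiplicative up to isomorphism. [cite: KedlayaPottharstXiao2014, Construction 6.2.4],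
[cite: BellaicheChenevier2009, §2.3.1 (arXiv:math/0602340 numbering)]
(A predicate ON the datum `𝓒`, nothing asserted; binder explicit for the fact census.) -/
def IsCompatible (𝓒 : 𝓣.RelativeCharData) : Prop :=
  (∀ δ : Fˣ →ₜ* Eˣ, (𝓒.ofCharOver E δ).IsEquiv ((𝓣.ofChar δ).baseChange E)) ∧
  (∀ (A : Type v) [CommRing A] [Algebra E A] [TopologicalSpace A] [IsTopologicalRing A]
      [Module.Finite E A] [Nontrivial A]
      (B : Type v) [CommRing B] [Algebra E B] [TopologicalSpace B] [IsTopologicalRing B]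
      [Module.Finite E B] [Nontrivial B]
      (σ : A →ₐ[E] B) (hσ : Continuous σ) (δ : Fˣ →ₜ* Aˣ),
      (𝓒.ofCharOver B ((ContinuousMonoidHom.mk (Units.map (σ : A →* B))
        (Continuous.units_map (σ : A →* B) hσ)).comp δ)).IsEquiv
        ((𝓒.ofCharOver A δ).map (𝓣.ring.baseChangeMap A σ) (𝓣.ring.baseChangeMap_frob A σ)
          (𝓣.ring.baseChangeMap_smul A σ))) ∧
  ∀ (A : Type v) [CommRing A] [Algebra E A] [TopologicalSpace A] [IsTopologicalRing A]
    [Module.Finite E A] [Nontrivial A] (δ δ' : Fˣ →ₜ* Aˣ),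
    (𝓒.ofCharOver A (δ * δ')).IsEquiv (𝓒.ofCharOver A δ * 𝓒.ofCharOver A δ')

end RelativeCharData

end PhiGammaModuleRobba

end Robba

end Literature.NumberTheory.GaloisRepresentations
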